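import Literature.Analysis.FluidPDE.TaoAveragedKSMeasure
import HarnessLib

/-!
# The rotation disintegration behind Tao 2016, §3.6 ("by a change of variables"), Haar-free

T. Tao, *Finite time blowup for an averaged three-dimensional Navier–Stokes equation*,
J. Amer. Math. Soc. **29** (2016), 601–674 = arXiv:1402.0290v3, §3.6 p. 18: having reduced
Theorem 3.2 to the tensor identity (3.15)/(3.16), Tao integrates over the slices
`Σ_{ξ₁,ξ₂,ξ₃} ⊂ SO(3)³` of the incidence manifold and then passes "by a change of variables" to an
integral over `U ⊂ SO(3)³` with Haar measure `dR₁ dR₂ dR₃`, the weight `F'` being "multiplied by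
some Jacobian factors"; in §3.7 the slice is parametrised by the ansatz
`Rⱼ = S R^{θⱼ}_{ξ̃ⱼ} R_{j,ξ}` (3.19)–(3.20) and one "averag[es] over all `S`".  For the
formalisation of the joint-weight identity `rotationAverage_jointWeight`
(`TaoAveragedRotationAveraging.lean`) the rotation triples are parametrised by three quaternions
`(a, b, c) ∈ ℍ³` (conjugation action `ρ`, `TaoAveragedQuaternionRotation.lean`), Haar measure is
replaced by Lebesgue measure on `ℍ ≅ ℝ⁴` with a radial profile `g`, and this file computes the
one thing the assembly needs from the change of variables: **the law of the frequency triple**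

  `Z(a,b,c,p₁,p₂) = (ρ(b̄) p₁, ρ(c̄) p₂, ρ(ā) p₃)`,  `p₃ = -p₁ - p₂`,

under the measure `g(|a|)g(|b|)g(|c|) χ(p₁,p₂) d(a,b,c) d(p₁,p₂)` for weights `χ` of *frame form*
`χ = R(|p₁|,|p₂|,|p₃|) · B(p₃/|p₃|, n)` (`n` the unit normal of the triangle): it is Lebesgue
measure on `(ℝ³)³` with the explicit density `c_B · 2π c_K² · R / (|ζ₁||ζ₂||ζ₃|)` on the
triangle-inequality region (`lintegral_rotation_disintegration`, `map_rotFreq_withDensity`,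
`integral_rotFreq_withDensity`).  The proof is entirely by measure-preserving substitutions plus
three flat Jacobians:

* **bipolar coordinates** `lintegral_norm_norm_add` — the law of `(|x|, |x+z|)`, `x` Lebesgue on
  `ℝ³`: density `2π r₁ r₂/|z|` on the triangle region (cylindrical coordinates about `z` via
  Mathlib's `polarCoord`, then the substitutions `r₁ = √(t²+ρ²)`, `r₂ = √(r₁²+|z|²+2|z|t)`);
* **gauge fixing** `lintegral_gauge_average` — the substitution
  `(b,c,p₁,p₂) ↦ (ub, uc, ρ(u)p₁, ρ(u)p₂)`, `u = a/|a|`, removes `a` from `Z` and replaces `χ` by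
  its rotation average (Tao's average over `S`, run backwards);
* **frame averaging** `lintegral_frameWeight_average` — that rotation average is
  `R · c_B` off the null set of degenerate pairs (`volume_cross_eq_zero`), by transitivity of unit
  quaternions on orthonormal pairs;
* **two-slot disintegration** `lintegral_pair_disintegration` — shear `(p₁,p₂) ↦ (p₁,p₃)`,
  alignment of the two slots (`lintegral_align`), bipolar coordinates in `p₁`, and the
  Kustaanheimo–Stiefel disintegration `(Kr)` (`lintegral_rot_radial`, `TaoAveragedKSMeasure.lean`)
  once per slot.

All statements are for measurable `ℝ≥0∞`-valued integrands (Tonelli throughout, no integrability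
hypotheses); the Bochner form is deduced from the measure identity.

## References

* T. Tao, J. Amer. Math. Soc. 29 (2016), 601–674, arXiv:1402.0290v3, §3.5–3.7 pp. 17–19.
  Key `Tao2016AveragedNS`.
-/

noncomputable section

open Real MeasureTheory Quaternion
open scoped RealInnerProductSpace Quaternion ENNReal

namespace Literature.Analysis.FluidPDE.Tao2016

/-- Local notation for physical / frequency space `ℝ³`. -/
local notation "ℝ³" => EuclideanSpace ℝ (Fin 3)

section Bipolar
open Set MeasureTheory.Measure ENNReal

attribute [local instance] quatMeasurableSpace quatBorelSpace

/-! ### Bipolar coordinates: the law of `(|x|, |x + z|)` under Lebesgue measure on `ℝ³` -/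

/-- The substitution `ρ ↦ r₁ = √(t² + ρ²)` (for fixed `t`): strictly increasing on `(0,∞)`. [folklore] -/
theorem strictMonoOn_sqrt_sq_add (t : ℝ) : StrictMonoOn (fun ρ : ℝ => Real.sqrt (t ^ 2 + ρ ^ 2)) (Ioi 0) := by
  intro a ha b hb hab
  simp only [mem_Ioi] at ha hb
  exact Real.sqrt_lt_sqrt (by positivity) (by nlinarith)

/-- Its image: `√(t² + ρ²)` maps `(0,∞)` onto `(|t|, ∞)`. [folklore] -/
theorem image_sqrt_sq_add (t : ℝ) : (fun ρ : ℝ => Real.sqrt (t ^ 2 + ρ ^ 2)) '' Ioi 0 = Ioi |t| := by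
  ext r
  simp only [mem_image, mem_Ioi]
  constructor
  · rintro ⟨ρ, hρ, rfl⟩
    calc |t| = Real.sqrt (t ^ 2) := (Real.sqrt_sq_eq_abs t).symm
      _ < Real.sqrt (t ^ 2 + ρ ^ 2) := Real.sqrt_lt_sqrt (sq_nonneg _) (by nlinarith)
  · intro hr
    have hr0 : 0 ≤ r := le_trans (abs_nonneg t) hr.le
    have ht2 : t ^ 2 < r ^ 2 := by
      have := sq_lt_sq' (by linarith [abs_nonneg t, neg_abs_le t]) (lt_of_le_of_lt (le_abs_self t) hr)
      simpa using this
    refine ⟨Real.sqrt (r ^ 2 - t ^ 2), Real.sqrt_pos.mpr (by linarith), ?_⟩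
    rw [Real.sq_sqrt (by linarith), add_sub_cancel, Real.sqrt_sq hr0]

/-- Its derivative: `d/dρ √(t² + ρ²) = ρ / √(t² + ρ²)` (`ρ > 0`). [folklore] -/
theorem hasDerivAt_sqrt_sq_add (t : ℝ) {ρ : ℝ} (hρ : 0 < ρ) :
    HasDerivAt (fun ρ : ℝ => Real.sqrt (t ^ 2 + ρ ^ 2)) (ρ / Real.sqrt (t ^ 2 + ρ ^ 2)) ρ := by
  have h1 : HasDerivAt (fun ρ : ℝ => t ^ 2 + ρ ^ 2) (2 * ρ) ρ := by
    simpa using (hasDerivAt_pow 2 ρ).const_add (t ^ 2)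
  have hpos : t ^ 2 + ρ ^ 2 ≠ 0 := by positivity
  convert h1.sqrt hpos using 1
  field_simp

/-- The substitution `t ↦ r₂ = √(r₁² + L² + 2Lt)` (for fixed `r₁, L > 0`): strictly increasing
on `(-r₁, r₁)`. [folklore] -/
theorem strictMonoOn_sqrt_affine {L : ℝ} (hL : 0 < L) (r₁ : ℝ) :
    StrictMonoOn (fun t : ℝ => Real.sqrt (r₁ ^ 2 + L ^ 2 + 2 * L * t)) (Ioo (-r₁) r₁) := by
  intro a ha b hb hab
  simp only [mem_Ioo] at ha hb
  have ha' : 0 ≤ r₁ ^ 2 + L ^ 2 + 2 * L * a := by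
    nlinarith [mul_pos hL (by linarith : 0 < a + r₁), sq_nonneg (r₁ - L)]
  exact Real.sqrt_lt_sqrt ha' (by nlinarith)

/-- Its image: `(-r₁, r₁) ↦ (|L - r₁|, L + r₁)` (`L, r₁ > 0`). [folklore] -/
theorem image_sqrt_affine {L r₁ : ℝ} (hL : 0 < L) (hr₁ : 0 < r₁) :
    (fun t : ℝ => Real.sqrt (r₁ ^ 2 + L ^ 2 + 2 * L * t)) '' Ioo (-r₁) r₁ = Ioo |L - r₁| (L + r₁) := by
  ext r
  simp only [mem_image, mem_Ioo]
  constructor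
  · rintro ⟨t, ⟨ht1, ht2⟩, rfl⟩
    constructor
    · calc |L - r₁| = Real.sqrt ((L - r₁) ^ 2) := (Real.sqrt_sq_eq_abs _).symm
        _ < _ := Real.sqrt_lt_sqrt (sq_nonneg _) (by nlinarith [mul_pos hL (by linarith : 0 < t + r₁)])
    · calc Real.sqrt (r₁ ^ 2 + L ^ 2 + 2 * L * t) < Real.sqrt ((L + r₁) ^ 2) :=
            Real.sqrt_lt_sqrt (by nlinarith [mul_pos hL (by linarith : 0 < t + r₁), sq_nonneg (r₁ - L)])
              (by nlinarith)
        _ = L + r₁ := Real.sqrt_sq (by linarith)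
  · rintro ⟨hr1, hr2⟩
    have hr0 : 0 ≤ r := le_trans (abs_nonneg _) hr1.le
    have hlow : (L - r₁) ^ 2 < r ^ 2 := by
      have := sq_lt_sq' (by linarith [abs_nonneg (L - r₁), neg_abs_le (L - r₁)])
        (lt_of_le_of_lt (le_abs_self _) hr1)
      simpa using this
    have hup : r ^ 2 < (L + r₁) ^ 2 := by nlinarith
    refine ⟨(r ^ 2 - r₁ ^ 2 - L ^ 2) / (2 * L), ⟨?_, ?_⟩, ?_⟩
    · rw [lt_div_iff₀ (by positivity)]; nlinarith
    · rw [div_lt_iff₀ (by positivity)]; nlinarith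
    · have : r₁ ^ 2 + L ^ 2 + 2 * L * ((r ^ 2 - r₁ ^ 2 - L ^ 2) / (2 * L)) = r ^ 2 := by
        field_simp; ring
      rw [this, Real.sqrt_sq hr0]

/-- Its derivative: `d/dt √(r₁² + L² + 2Lt) = L / √(r₁² + L² + 2Lt)` where the radicand is positive. [folklore] -/
theorem hasDerivAt_sqrt_affine (L r₁ : ℝ) {t : ℝ} (ht : 0 < r₁ ^ 2 + L ^ 2 + 2 * L * t) :
    HasDerivAt (fun t : ℝ => Real.sqrt (r₁ ^ 2 + L ^ 2 + 2 * L * t))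
      (L / Real.sqrt (r₁ ^ 2 + L ^ 2 + 2 * L * t)) t := by
  have h1 : HasDerivAt (fun t : ℝ => r₁ ^ 2 + L ^ 2 + 2 * L * t) (2 * L) t := by
    simpa using ((hasDerivAt_id t).const_mul (2 * L)).const_add (r₁ ^ 2 + L ^ 2)
  convert h1.sqrt ht.ne' using 1
  field_simp

/-- Reduction of `‖x + z‖` to a fixed direction: for a linear isometry `M` with `M (L e₀) = z`,
`∫ Φ(|x|, |x + z|) dx = ∫ Φ(|y|, |y + L e₀|) dy`. [folklore] -/
theorem lintegral_norm_norm_add_rotate (M : ℝ³ ≃ₗᵢ[ℝ] ℝ³) (z : ℝ³) (L : ℝ) (hM : M (L • ksE0) = z)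
    (Φ : ℝ → ℝ → ℝ≥0∞) :
    ∫⁻ x : ℝ³, Φ ‖x‖ ‖x + z‖ = ∫⁻ y : ℝ³, Φ ‖y‖ ‖y + L • ksE0‖ := by
  rw [← M.measurePreserving.lintegral_comp_emb M.toHomeomorph.measurableEmbedding]
  refine lintegral_congr fun y => ?_
  show Φ ‖M y‖ ‖M y + z‖ = _
  rw [LinearIsometryEquiv.norm_map, ← hM, ← map_add, LinearIsometryEquiv.norm_map]

/-- `|y|²` and `|y + L e₀|²` in coordinates. [folklore] -/
theorem norm_sq_add_smul_ksE0 (y : ℝ³) (L : ℝ) :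
    ‖y‖ ^ 2 = y 0 ^ 2 + (y 1 ^ 2 + y 2 ^ 2) ∧ ‖y + L • ksE0‖ ^ 2 = (y 0 + L) ^ 2 + (y 1 ^ 2 + y 2 ^ 2) := by
  constructor
  · rw [EuclideanSpace.norm_sq_eq]; simp [Fin.sum_univ_three, add_assoc]
  · rw [EuclideanSpace.norm_sq_eq]; simp [Fin.sum_univ_three, ksE0, add_assoc]

/-- **Bipolar coordinates on `ℝ³`**: for `z ≠ 0` with `L = |z|` and measurable `Φ ≥ 0`,
`∫_{ℝ³} Φ(|x|, |x + z|) dx = (2π/L) ∫_{r₁>0} ∫_{|L-r₁| < r₂ < L+r₁} r₁ r₂ Φ(r₁, r₂) dr₂ dr₁`,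
i.e. the pair of distances to the two foci `0, -z` has density `2π r₁ r₂ / L` on the triangle-
inequality region (cylindrical coordinates about the axis `z`, then the two one-dimensional
substitutions `r₁ = √(t² + ρ²)`, `r₂ = √(r₁² + L² + 2Lt)` with `ρ dρ = r₁ dr₁`, `L dt = r₂ dr₂`).
This is the `(ξ₁', ξ₂')`-part of the Jacobian of Tao's change of variables to frequency
magnitudes (§3.6). [cite: Tao2016AveragedNS, §3.6 p. 18] -/
theorem lintegral_norm_norm_add {z : ℝ³} (hz : z ≠ 0) (Φ : ℝ → ℝ → ℝ≥0∞) (hΦ : Measurable (Function.uncurry Φ)) :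
    ∫⁻ x : ℝ³, Φ ‖x‖ ‖x + z‖ = ENNReal.ofReal (2 * π / ‖z‖) *
      ∫⁻ r₁ in Ioi (0 : ℝ), ∫⁻ r₂ in Ioo |‖z‖ - r₁| (‖z‖ + r₁), ENNReal.ofReal (r₁ * r₂) * Φ r₁ r₂ := by
  set L := ‖z‖ with hL
  have hL0 : 0 < L := norm_pos_iff.mpr hz
  -- (a) rotate `z` to `L e₀`
  obtain ⟨s, hs1, hse⟩ := exists_unit_qrotFun_eq norm_ksE0 (show ‖(L⁻¹ : ℝ) • z‖ = 1 from norm_smul_inv_norm hz)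
  have hs0 : s ≠ 0 := by intro h; rw [h, norm_zero] at hs1; exact zero_ne_one hs1
  have hM : qrot s (L • ksE0) = z := by
    rw [map_smul, qrot_apply hs0, hse, smul_smul, mul_inv_cancel₀ hL0.ne', one_smul]
  rw [lintegral_norm_norm_add_rotate (qrot s) z L hM]
  -- (b) coordinates and cylindrical radius
  set F : ℝ × ℝ × ℝ → ℝ≥0∞ := fun p => Φ (Real.sqrt (p.1 ^ 2 + (p.2.1 ^ 2 + p.2.2 ^ 2)))
    (Real.sqrt ((p.1 + L) ^ 2 + (p.2.1 ^ 2 + p.2.2 ^ 2))) with hF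
  have hcoord : ∀ y : ℝ³, Φ ‖y‖ ‖y + L • ksE0‖ = F (y 0, y 1, y 2) := by
    intro y
    obtain ⟨h1, h2⟩ := norm_sq_add_smul_ksE0 y L
    rw [hF]
    simp only
    rw [← h1, ← h2, Real.sqrt_sq (norm_nonneg _), Real.sqrt_sq (norm_nonneg _)]
  rw [lintegral_congr hcoord, lintegral_comp_euc3Equiv F, hF]
  set Ψ : ℝ → ℝ → ℝ≥0∞ := fun t P => Φ (Real.sqrt (t ^ 2 + P)) (Real.sqrt ((t + L) ^ 2 + P)) with hΨ
  have hΨm : Measurable (Function.uncurry Ψ) := by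
    rw [hΨ]
    exact hΦ.comp ((Measurable.sqrt (by fun_prop)).prodMk (Measurable.sqrt (by fun_prop)))
  have hstep_b : ∫⁻ p : ℝ × ℝ × ℝ, Φ (Real.sqrt (p.1 ^ 2 + (p.2.1 ^ 2 + p.2.2 ^ 2)))
      (Real.sqrt ((p.1 + L) ^ 2 + (p.2.1 ^ 2 + p.2.2 ^ 2))) =
      ∫⁻ t : ℝ, ∫⁻ uv : ℝ × ℝ, Ψ t (uv.1 ^ 2 + uv.2 ^ 2) := by
    rw [Measure.volume_eq_prod, lintegral_prod _ (Measurable.aemeasurable ?_)]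
    exact hΨm.comp (measurable_fst.prodMk (by fun_prop))
  rw [hstep_b]
  -- (c) polar in `(u,v)` and (d) `ρ ↦ r₁`
  have hstep_cd : ∀ t : ℝ, ∫⁻ uv : ℝ × ℝ, Ψ t (uv.1 ^ 2 + uv.2 ^ 2) =
      ENNReal.ofReal (2 * π) * ∫⁻ r₁ in Ioi |t|, ENNReal.ofReal r₁ * Φ r₁ (Real.sqrt (r₁ ^ 2 + L ^ 2 + 2 * L * t)) := by
    intro t
    have hΨt : Measurable (Ψ t) := hΨm.comp (measurable_const.prodMk measurable_id)
    rw [lintegral_radial_prod (Ψ t) hΨt, ← image_sqrt_sq_add t,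
      lintegral_image_eq_lintegral_abs_deriv_mul measurableSet_Ioi
        (fun ρ hρ => (hasDerivAt_sqrt_sq_add t hρ).hasDerivWithinAt) (strictMonoOn_sqrt_sq_add t).injOn]
    congr 1
    refine setLIntegral_congr_fun measurableSet_Ioi fun ρ hρ => ?_
    rw [mem_Ioi] at hρ
    have hr₁ : 0 < Real.sqrt (t ^ 2 + ρ ^ 2) := Real.sqrt_pos.mpr (by positivity)
    rw [hΨ]
    simp only
    rw [← mul_assoc, ← ENNReal.ofReal_mul (abs_nonneg _), abs_of_pos (div_pos hρ hr₁),
      div_mul_cancel₀ _ hr₁.ne', Real.sq_sqrt (by positivity)]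
    congr 2
    ring_nf
  simp_rw [hstep_cd]
  -- (e) swap `t` and `r₁`
  set G : ℝ → ℝ → ℝ≥0∞ := fun t r₁ => ENNReal.ofReal r₁ * Φ r₁ (Real.sqrt (r₁ ^ 2 + L ^ 2 + 2 * L * t)) with hG
  have hGm : Measurable (Function.uncurry G) := by
    rw [hG]
    exact (ENNReal.measurable_ofReal.comp measurable_snd).mul
      (hΦ.comp (measurable_snd.prodMk (Measurable.sqrt (by fun_prop))))
  have hind : ∀ t : ℝ, ∫⁻ r₁ in Ioi |t|, G t r₁ = ∫⁻ r₁ : ℝ, {p : ℝ × ℝ | |p.1| < p.2}.indicator (Function.uncurry G) (t, r₁) := by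
    intro t
    rw [← lintegral_indicator measurableSet_Ioi]
    congr 1
  have hSm : MeasurableSet {p : ℝ × ℝ | |p.1| < p.2} :=
    measurableSet_lt (continuous_abs.measurable.comp measurable_fst) measurable_snd
  simp_rw [show ∀ t : ℝ, (∫⁻ r₁ in Ioi |t|, ENNReal.ofReal r₁ * Φ r₁ (Real.sqrt (r₁ ^ 2 + L ^ 2 + 2 * L * t))) =
    ∫⁻ r₁ in Ioi |t|, G t r₁ from fun t => rfl, hind]
  rw [lintegral_const_mul _ ((hGm.indicator hSm).lintegral_prod_right'),
    lintegral_lintegral_swap (f := fun t r₁ => {p : ℝ × ℝ | |p.1| < p.2}.indicator (Function.uncurry G) (t, r₁))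
      (by exact (hGm.indicator hSm).aemeasurable)]
  -- restrict `r₁` to `(0,∞)` and identify the `t`-section
  have hsec : ∀ r₁ : ℝ, ∫⁻ t : ℝ, {p : ℝ × ℝ | |p.1| < p.2}.indicator (Function.uncurry G) (t, r₁) =
      (Ioi (0 : ℝ)).indicator (fun r₁ => ∫⁻ t in Ioo (-r₁) r₁, G t r₁) r₁ := by
    intro r₁
    by_cases hr₁ : 0 < r₁
    · rw [indicator_of_mem (mem_Ioi.mpr hr₁), ← lintegral_indicator measurableSet_Ioo]
      congr 1
      funext t
      simp only [indicator, mem_setOf_eq, mem_Ioo, abs_lt, Function.uncurry_apply_pair]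
    · rw [indicator_of_notMem (by simpa using hr₁)]
      have : ∀ t : ℝ, {p : ℝ × ℝ | |p.1| < p.2}.indicator (Function.uncurry G) (t, r₁) = 0 := by
        intro t
        apply indicator_of_notMem
        simp only [mem_setOf_eq, not_lt]
        exact le_trans (not_lt.mp hr₁) (abs_nonneg t)
      simp_rw [this, lintegral_zero]
  simp_rw [hsec]
  rw [lintegral_indicator measurableSet_Ioi]
  -- (f) `t ↦ r₂` for fixed `r₁ > 0`
  have hstep_f : ∀ r₁ ∈ Ioi (0 : ℝ), ∫⁻ t in Ioo (-r₁) r₁, G t r₁ =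
      ∫⁻ r₂ in Ioo |L - r₁| (L + r₁), ENNReal.ofReal (r₁ * r₂ / L) * Φ r₁ r₂ := by
    intro r₁ hr₁
    rw [mem_Ioi] at hr₁
    have hpos : ∀ t ∈ Ioo (-r₁) r₁, 0 < r₁ ^ 2 + L ^ 2 + 2 * L * t := by
      intro t ht; rw [mem_Ioo] at ht
      nlinarith [mul_pos hL0 (by linarith : 0 < t + r₁), sq_nonneg (r₁ - L)]
    rw [← image_sqrt_affine hL0 hr₁, lintegral_image_eq_lintegral_abs_deriv_mul measurableSet_Ioo
      (fun t ht => (hasDerivAt_sqrt_affine L r₁ (hpos t ht)).hasDerivWithinAt)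
      (strictMonoOn_sqrt_affine hL0 r₁).injOn]
    refine setLIntegral_congr_fun measurableSet_Ioo fun t ht => ?_
    have hr₂ : 0 < Real.sqrt (r₁ ^ 2 + L ^ 2 + 2 * L * t) := Real.sqrt_pos.mpr (hpos t ht)
    rw [hG]
    simp only
    rw [← mul_assoc, ← ENNReal.ofReal_mul (abs_nonneg _), abs_of_pos (div_pos hL0 hr₂)]
    congr 2
    have hR : Real.sqrt (r₁ ^ 2 + L ^ 2 + 2 * L * t) ≠ 0 := hr₂.ne'
    symm
    calc L / Real.sqrt (r₁ ^ 2 + L ^ 2 + 2 * L * t) * (r₁ * Real.sqrt (r₁ ^ 2 + L ^ 2 + 2 * L * t) / L)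
          = (L / L) * (Real.sqrt (r₁ ^ 2 + L ^ 2 + 2 * L * t) / Real.sqrt (r₁ ^ 2 + L ^ 2 + 2 * L * t)) * r₁ := by
          ring
      _ = r₁ := by rw [div_self hL0.ne', div_self hR, one_mul, one_mul]
  rw [setLIntegral_congr_fun measurableSet_Ioi hstep_f]
  -- (g) constants
  have hconst : ∀ r₁ : ℝ, ∫⁻ r₂ in Ioo |L - r₁| (L + r₁), ENNReal.ofReal (r₁ * r₂ / L) * Φ r₁ r₂ =
      ENNReal.ofReal L⁻¹ * ∫⁻ r₂ in Ioo |L - r₁| (L + r₁), ENNReal.ofReal (r₁ * r₂) * Φ r₁ r₂ := by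
    intro r₁
    rw [← lintegral_const_mul' _ _ ENNReal.ofReal_ne_top]
    refine setLIntegral_congr_fun measurableSet_Ioo fun r₂ hr₂ => ?_
    have hr₂0 : 0 ≤ r₂ := le_trans (abs_nonneg _) hr₂.1.le
    by_cases hr₁ : 0 ≤ r₁
    · rw [← mul_assoc, ← ENNReal.ofReal_mul (inv_nonneg.mpr hL0.le)]
      congr 2
      rw [div_eq_inv_mul]
    · -- `r₁ < 0`: both sides vanish since `ofReal` of a non-positive number is `0`
      have h1 : r₁ * r₂ ≤ 0 := mul_nonpos_of_nonpos_of_nonneg (le_of_lt (not_le.mp hr₁)) hr₂0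
      rw [ENNReal.ofReal_of_nonpos (div_nonpos_of_nonpos_of_nonneg h1 hL0.le),
        ENNReal.ofReal_of_nonpos h1, zero_mul, mul_zero]
  simp_rw [hconst]
  rw [lintegral_const_mul' _ _ ENNReal.ofReal_ne_top, ← mul_assoc, ← ENNReal.ofReal_mul (by positivity)]
  congr 2

end Bipolar
section DisintegrationHelpers
open Set MeasureTheory.Measure ENNReal

attribute [local instance] quatMeasurableSpace quatBorelSpace

/-! ### Helpers: unit quaternions, alignment of a slot, interval form of `(Kr)` -/

/-- `q̄ · (q/|q|) = |q|`. [folklore] -/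
theorem star_self_mul_quatUnit (q : ℍ) : star q * quatUnit q = ((‖q‖ : ℝ) : ℍ) := by
  by_cases hq : q = 0
  · subst hq; simp [quatUnit]
  rw [quatUnit, mul_smul_comm, star_mul_self, normSq_eq_norm_mul_self]
  have hn : ‖q‖ ≠ 0 := norm_ne_zero_iff.mpr hq
  ext <;> simp [hn]

/-- `ρ(q̄) ρ(q/|q|) = id` (`q ≠ 0`). [folklore] -/
theorem qrotFun_star_quatUnit {q : ℍ} (hq : q ≠ 0) (v : ℝ³) :
    qrotFun (star q) (qrotFun (quatUnit q) v) = v := by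
  rw [← qrotFun_mul, star_self_mul_quatUnit, qrotFun_coe (norm_ne_zero_iff.mpr hq)]

/-- `ρ((u b)‾) (ρ(u) v) = ρ(b̄) v` for a unit quaternion `u`. [folklore] -/
theorem qrotFun_star_mul_left {u : ℍ} (hu : ‖u‖ = 1) (b : ℍ) (v : ℝ³) :
    qrotFun (star (u * b)) (qrotFun u v) = qrotFun (star b) v := by
  have hu0 : u ≠ 0 := by intro h; rw [h, norm_zero] at hu; exact zero_ne_one hu
  rw [star_mul, qrotFun_mul, qrotFun_star_self hu0]

/-- **Alignment of a slot**: averaging over `b ∈ ℍ` with a radial weight, the vector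
`ρ(b̄) v` may be replaced by `|v| ρ(b̄) e₀` (left translation by a unit quaternion taking `e₀`
to `v/|v|`). [folklore] -/
theorem lintegral_align (g : ℝ → ℝ≥0∞) (v : ℝ³) (φ : ℝ³ → ℝ≥0∞) :
    ∫⁻ b : ℍ, g ‖b‖ * φ (qrotFun (star b) v) = ∫⁻ b : ℍ, g ‖b‖ * φ (‖v‖ • qrotFun (star b) ksE0) := by
  by_cases hv : v = 0
  · subst hv; simp
  obtain ⟨m, hm1, hme⟩ := exists_unit_qrotFun_eq norm_ksE0 (norm_udir hv)
  have hm0 : m ≠ 0 := by intro h; rw [h, norm_zero] at hm1; exact zero_ne_one hm1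
  rw [← lintegral_comp_quat_mul_left hm1 (fun b => g ‖b‖ * φ (qrotFun (star b) v))]
  refine lintegral_congr fun b => ?_
  simp only [norm_mul, hm1, one_mul]
  congr 2
  rw [star_mul, qrotFun_mul]
  conv_lhs => rw [eq_norm_smul_udir hv, qrotFun_smul, ← hme, qrotFun_star_self hm0]
  rw [qrotFun_smul]

/-- **`(Kr)` on an interval**: the disintegration `lintegral_rot_radial` with the radial
variable restricted to `(α, β) ⊆ (0, ∞)`. [folklore] -/
theorem lintegral_rot_radial_Ioo (g : ℝ → ℝ≥0∞) (hg : Measurable g) (Φ : ℝ → ℝ≥0∞) (hΦ : Measurable Φ)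
    (k : ℝ³ → ℝ≥0∞) (hk : Measurable k) {α β : ℝ} (hα : 0 ≤ α) :
    ∫⁻ r in Ioo α β, ∫⁻ q : ℍ, g ‖q‖ * Φ r * k (r • qrotFun (star q) ksE0) =
      ENNReal.ofReal (π / 4) * ksRadialConst g *
        ∫⁻ x : ℝ³, k x * (Ioo α β).indicator Φ ‖x‖ * ENNReal.ofReal (‖x‖ ^ 2)⁻¹ := by
  rw [← lintegral_rot_radial g hg _ (hΦ.indicator measurableSet_Ioo) k hk]
  have hsub : Ioo α β ⊆ Ioi 0 := fun r hr => lt_of_le_of_lt hα hr.1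
  rw [← lintegral_indicator measurableSet_Ioo, ← lintegral_indicator measurableSet_Ioi]
  refine lintegral_congr fun r => ?_
  by_cases hr : r ∈ Ioo α β
  · rw [indicator_of_mem hr, indicator_of_mem (hsub hr)]
    simp only [indicator_of_mem hr]
  · rw [indicator_of_notMem hr]
    by_cases hr' : r ∈ Ioi (0 : ℝ)
    · rw [indicator_of_mem hr']
      simp only [indicator_of_notMem hr, mul_zero, zero_mul, lintegral_zero]
    · rw [indicator_of_notMem hr']

/-! ### Measure-preserving rearrangements -/

/-- The shear-reflection `(p₁, z) ↦ (p₁, -p₁ - z)` of `ℝ³ × ℝ³` preserves Lebesgue measure. [folklore] -/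
theorem measurePreserving_shearNeg :
    MeasurePreserving (fun x : ℝ³ × ℝ³ => (x.1, -x.1 - x.2)) volume volume := by
  have h1 : MeasurePreserving (fun x : ℝ³ × ℝ³ => (x.1, x.1 + x.2)) volume volume := by
    rw [Measure.volume_eq_prod]; exact measurePreserving_prod_add volume volume
  have h2 : MeasurePreserving (Prod.map (id : ℝ³ → ℝ³) (LinearIsometryEquiv.neg ℝ : ℝ³ ≃ₗᵢ[ℝ] ℝ³))
      volume volume := by
    rw [Measure.volume_eq_prod]
    exact (MeasurePreserving.id volume).prod (LinearIsometryEquiv.neg ℝ : ℝ³ ≃ₗᵢ[ℝ] ℝ³).measurePreserving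
  have h := h2.comp h1
  convert h using 1
  funext x
  simp only [Function.comp_apply, Prod.map_apply, id_eq, LinearIsometryEquiv.coe_neg, Prod.mk.injEq,
    true_and]
  abel

/-- The gauge map `((b, c), (p₁, p₂)) ↦ ((u b, u c), (ρ(u) p₁, ρ(u) p₂))` preserves Lebesgue
measure on `(ℍ × ℍ) × (ℝ³ × ℝ³)` for a unit quaternion `u`. [folklore] -/
theorem measurePreserving_gauge {u : ℍ} (hu : ‖u‖ = 1) :
    MeasurePreserving (fun y : (ℍ × ℍ) × (ℝ³ × ℝ³) => ((u * y.1.1, u * y.1.2), (qrot u y.2.1, qrot u y.2.2)))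
      volume volume := by
  have h : MeasurePreserving (Prod.map (Prod.map (quatLmul u hu) (quatLmul u hu)) (Prod.map (qrot u) (qrot u)))
      volume volume := by
    rw [Measure.volume_eq_prod, Measure.volume_eq_prod (ℍ) (ℍ), Measure.volume_eq_prod ℝ³ ℝ³]
    exact ((quatLmul u hu).measurePreserving.prod (quatLmul u hu).measurePreserving).prod
      ((qrot u).measurePreserving.prod (qrot u).measurePreserving)
  convert h using 1
  funext y; rfl

/-- Regrouping `(a, (b, c)), p) ↦ (a, ((b, c), p))` preserves product Lebesgue measure. [folklore] -/
theorem measurePreserving_regroup :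
    MeasurePreserving (fun x : (ℍ × ℍ × ℍ) × (ℝ³ × ℝ³) => (x.1.1, (x.1.2, x.2))) volume volume := by
  have h : MeasurePreserving (MeasurableEquiv.prodAssoc : (ℍ × (ℍ × ℍ)) × (ℝ³ × ℝ³) ≃ᵐ ℍ × ((ℍ × ℍ) × (ℝ³ × ℝ³)))
      volume volume := by
    refine ⟨MeasurableEquiv.prodAssoc.measurable, ?_⟩
    rw [Measure.volume_eq_prod, Measure.volume_eq_prod, Measure.volume_eq_prod, Measure.volume_eq_prod]
    exact Measure.prodAssoc_prod
  convert h using 1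
  funext x; rfl

end DisintegrationHelpers
section PairDisintegration
open Set MeasureTheory.Measure ENNReal

attribute [local instance] quatMeasurableSpace quatBorelSpace

/-! ### The two-slot disintegration `(D2)` -/

/-- The scaled slot vector `(r, b) ↦ r ρ(b̄) e₀` is measurable. [folklore] -/
theorem measurable_slotVec : Measurable fun x : ℝ × ℍ => x.1 • qrotFun (star x.2) ksE0 :=
  measurable_fst.smul ((measurable_qrotFun_star_apply ksE0).comp measurable_snd)

/-- `(b, p) ↦ ρ(b̄) p` is measurable (via the polynomial formula for the conjugation action). [folklore] -/
theorem measurable_qrotFun_star_uncurry : Measurable fun x : ℍ × ℝ³ => qrotFun (star x.1) x.2 := by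
  unfold qrotFun
  refine ((continuous_normSq.measurable.comp (contDiff_quat_star (n := 0)).continuous.measurable).comp
    measurable_fst).inv.smul ?_
  refine (contDiff_vecOf (n := 0)).continuous.measurable.comp ?_
  exact ((((contDiff_quat_star (n := 0)).continuous.comp continuous_fst).mul
    ((contDiff_quatOf (n := 0)).continuous.comp continuous_snd)).mul
    ((continuous_star.comp ((contDiff_quat_star (n := 0)).continuous.comp continuous_fst)))).measurable

/-- Composition form of `measurable_qrotFun_star_uncurry`. [folklore] -/
theorem _root_.Measurable.qrotFun_star {α : Type*} [MeasurableSpace α] {f : α → ℍ} {v : α → ℝ³}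
    (hf : Measurable f) (hv : Measurable v) : Measurable fun a => qrotFun (star (f a)) (v a) := by
  have h := measurable_qrotFun_star_uncurry.comp (hf.prodMk hv)
  exact h

/-- `(b, p) ↦ ρ(b) p` is measurable. [folklore] -/
theorem measurable_qrotFun_uncurry : Measurable fun x : ℍ × ℝ³ => qrotFun x.1 x.2 := by
  have h1 : Measurable fun x : ℍ × ℝ³ => qrotFun (star (star x.1)) x.2 :=
    (Measurable.qrotFun_star (continuous_star.measurable.comp measurable_fst) measurable_snd)
  simpa only [star_star] using h1

/-- Composition form of `measurable_qrotFun_uncurry`. [folklore] -/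
theorem _root_.Measurable.qrotFun {α : Type*} [MeasurableSpace α] {f : α → ℍ} {v : α → ℝ³}
    (hf : Measurable f) (hv : Measurable v) : Measurable fun a => qrotFun (f a) (v a) := by
  have h := measurable_qrotFun_uncurry.comp (hf.prodMk hv)
  exact h

/-- **The triangle weight** produced by the two-slot disintegration: the indicator of the
triangle inequality `|‖ζ₃‖ - ‖ζ₁‖| < ‖ζ₂‖ < ‖ζ₃‖ + ‖ζ₁‖`, the radial weight `K`, and the Jacobian
factor `(‖ζ₁‖ ‖ζ₂‖ ‖ζ₃‖)⁻¹`. [folklore] -/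
def triWeight (K : ℝ → ℝ → ℝ → ℝ≥0∞) (ζ : ℝ³ × ℝ³ × ℝ³) : ℝ≥0∞ :=
  (Ioo |‖ζ.2.2‖ - ‖ζ.1‖| (‖ζ.2.2‖ + ‖ζ.1‖)).indicator (fun _ => (1 : ℝ≥0∞)) ‖ζ.2.1‖ *
    K ‖ζ.1‖ ‖ζ.2.1‖ ‖ζ.2.2‖ * ENNReal.ofReal (‖ζ.1‖ * ‖ζ.2.1‖ * ‖ζ.2.2‖)⁻¹

/-- `triWeight` is measurable. [folklore] -/
theorem measurable_triWeight {K : ℝ → ℝ → ℝ → ℝ≥0∞} (hK : Measurable fun r : ℝ × ℝ × ℝ => K r.1 r.2.1 r.2.2) :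
    Measurable (triWeight K) := by
  unfold triWeight
  refine ((Measurable.ite ?_ measurable_const measurable_const).mul
    (hK.comp (measurable_fst.norm.prodMk ((measurable_fst.comp measurable_snd).norm.prodMk
      (measurable_snd.comp measurable_snd).norm)))).mul (ENNReal.measurable_ofReal.comp ?_)
  · simp only [mem_Ioo, setOf_and]
    refine (measurableSet_lt ?_ (measurable_fst.comp measurable_snd).norm).inter
      (measurableSet_lt (measurable_fst.comp measurable_snd).norm ?_)
    · exact continuous_abs.measurable.comp ((measurable_snd.comp measurable_snd).norm.sub measurable_fst.norm)
    · exact (measurable_snd.comp measurable_snd).norm.add measurable_fst.norm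
  · exact ((measurable_fst.norm.mul (measurable_fst.comp measurable_snd).norm).mul
      (measurable_snd.comp measurable_snd).norm).inv

/-- The aligned two-slot average `(r₁, r₂) ↦ ∫∫ g(|b|) g(|c|) h(r₁ρ(b̄)e₀, r₂ρ(c̄)e₀, z)` and its
building block are measurable. [folklore] -/
theorem measurable_twoSlot (g : ℝ → ℝ≥0∞) (hg : Measurable g) (h : ℝ³ × ℝ³ × ℝ³ → ℝ≥0∞) (hh : Measurable h) :
    Measurable fun x : (ℝ³ × ℝ × ℝ) × ℍ × ℍ =>
      g ‖x.2.1‖ * g ‖x.2.2‖ * h (x.1.2.1 • qrotFun (star x.2.1) ksE0, x.1.2.2 • qrotFun (star x.2.2) ksE0, x.1.1) := by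
  have hgn : Measurable fun b : ℍ => g ‖b‖ := hg.comp measurable_norm
  have h1 : Measurable fun x : (ℝ³ × ℝ × ℝ) × ℍ × ℍ => g ‖x.2.1‖ := hgn.comp (measurable_fst.comp measurable_snd)
  have h2 : Measurable fun x : (ℝ³ × ℝ × ℝ) × ℍ × ℍ => g ‖x.2.2‖ := hgn.comp (measurable_snd.comp measurable_snd)
  have hr1 : Measurable fun x : (ℝ³ × ℝ × ℝ) × ℍ × ℍ => (x.1.2.1, x.2.1) :=
    ((measurable_fst.comp measurable_snd).comp measurable_fst).prodMk (measurable_fst.comp measurable_snd)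
  have hr2 : Measurable fun x : (ℝ³ × ℝ × ℝ) × ℍ × ℍ => (x.1.2.2, x.2.2) :=
    ((measurable_snd.comp measurable_snd).comp measurable_fst).prodMk (measurable_snd.comp measurable_snd)
  have hs1 : Measurable fun x : (ℝ³ × ℝ × ℝ) × ℍ × ℍ => x.1.2.1 • qrotFun (star x.2.1) ksE0 :=
    measurable_slotVec.comp hr1
  have hs2 : Measurable fun x : (ℝ³ × ℝ × ℝ) × ℍ × ℍ => x.1.2.2 • qrotFun (star x.2.2) ksE0 :=
    measurable_slotVec.comp hr2
  have hz : Measurable fun x : (ℝ³ × ℝ × ℝ) × ℍ × ℍ => x.1.1 := measurable_fst.comp measurable_fst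
  exact (h1.mul h2).mul (hh.comp (hs1.prodMk (hs2.prodMk hz)))

/-- **Two-slot disintegration `(D2)`.** For a radial quaternion profile `g`, a radial weight
`K(|p₁|, |p₂|, |p₃|)` and a measurable `h ≥ 0` on `(ℝ³)³`,
`∫ g(|b|) g(|c|) K h(ρ(b̄)p₁, ρ(c̄)p₂, p₃) d(b,c,p₁,p₂)` (with `p₃ = -p₁-p₂`) equals
`2π c_K² ∫ triWeight K ζ · h(ζ) dζ`: the pair of quaternion-rotated frequencies together with
the closing frequency `p₃` is Lebesgue-distributed on `(ℝ³)³` with density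
`2π c_K² K / (|ζ₁||ζ₂||ζ₃|)` on the triangle-inequality region (shear `(p₁,p₂) ↦ (p₁, p₃)`,
alignment of the two slots, bipolar coordinates `lintegral_norm_norm_add`, and `(Kr)` twice).
This is the `(ξ₁, ξ₂)`-and-two-rotations part of the Jacobian in Tao's "by a change of
variables" (§3.6). [cite: Tao2016AveragedNS, §3.6 p. 18] -/
theorem lintegral_pair_disintegration (g : ℝ → ℝ≥0∞) (hg : Measurable g)
    (K : ℝ → ℝ → ℝ → ℝ≥0∞) (hK : Measurable fun r : ℝ × ℝ × ℝ => K r.1 r.2.1 r.2.2)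
    (h : ℝ³ × ℝ³ × ℝ³ → ℝ≥0∞) (hh : Measurable h) :
    ∫⁻ y : (ℍ × ℍ) × (ℝ³ × ℝ³), g ‖y.1.1‖ * g ‖y.1.2‖ * K ‖y.2.1‖ ‖y.2.2‖ ‖-y.2.1 - y.2.2‖ *
        h (qrotFun (star y.1.1) y.2.1, qrotFun (star y.1.2) y.2.2, -y.2.1 - y.2.2) =
      ENNReal.ofReal (2 * π) * (ENNReal.ofReal (π / 4) * ksRadialConst g) ^ 2 *
        ∫⁻ ζ : ℝ³ × ℝ³ × ℝ³, triWeight K ζ * h ζ := by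
  set cK : ℝ≥0∞ := ENNReal.ofReal (π / 4) * ksRadialConst g with hcK
  -- measurability kit
  have hgn : Measurable fun b : ℍ => g ‖b‖ := hg.comp measurable_norm
  have hK3 : ∀ {α : Type} [MeasurableSpace α] {f₁ f₂ f₃ : α → ℝ}, Measurable f₁ → Measurable f₂ → Measurable f₃ →
      Measurable fun a => K (f₁ a) (f₂ a) (f₃ a) := fun h1 h2 h3 => hK.comp (h1.prodMk (h2.prodMk h3))
  have hrot : ∀ v : ℝ³, Measurable fun b : ℍ => qrotFun (star b) v := measurable_qrotFun_star_apply
  have hsv : ∀ r : ℝ, Measurable fun b : ℍ => r • qrotFun (star b) ksE0 := fun r => (hrot ksE0).const_smul r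
  -- the basic slot-`c` integrand and its measurability
  have hmc : ∀ (w : ℝ³) (r : ℝ) (z : ℝ³), Measurable fun c : ℍ => g ‖c‖ * h (w, r • qrotFun (star c) ksE0, z) :=
    fun w r z => hgn.mul (hh.comp (measurable_const.prodMk ((hsv r).prodMk measurable_const)))
  have hmu : ∀ (w v z : ℝ³), Measurable fun c : ℍ => g ‖c‖ * h (w, qrotFun (star c) v, z) :=
    fun w v z => hgn.mul (hh.comp (measurable_const.prodMk ((hrot v).prodMk measurable_const)))
  have hmbc : ∀ (r₁ r₂ : ℝ) (z : ℝ³), Measurable fun bc : ℍ × ℍ =>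
      g ‖bc.1‖ * g ‖bc.2‖ * h (r₁ • qrotFun (star bc.1) ksE0, r₂ • qrotFun (star bc.2) ksE0, z) :=
    fun r₁ r₂ z => (measurable_twoSlot g hg h hh).comp (f := fun bc : ℍ × ℍ => (((z, r₁, r₂) : ℝ³ × ℝ × ℝ), bc))
      (measurable_const.prodMk measurable_id)
  have hmbc' : ∀ (r₁ r₂ : ℝ) (z : ℝ³) (b : ℍ), Measurable fun c : ℍ =>
      g ‖b‖ * g ‖c‖ * h (r₁ • qrotFun (star b) ksE0, r₂ • qrotFun (star c) ksE0, z) :=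
    fun r₁ r₂ z b => (hmbc r₁ r₂ z).comp (f := fun c : ℍ => (b, c)) (measurable_const.prodMk measurable_id)
  -- Step 1: Tonelli, `p` outside
  set Ψ : (ℍ × ℍ) × (ℝ³ × ℝ³) → ℝ≥0∞ := fun y => g ‖y.1.1‖ * g ‖y.1.2‖ * K ‖y.2.1‖ ‖y.2.2‖ ‖-y.2.1 - y.2.2‖ *
    h (qrotFun (star y.1.1) y.2.1, qrotFun (star y.1.2) y.2.2, -y.2.1 - y.2.2) with hΨ
  have hΨm : Measurable Ψ := by
    rw [hΨ]
    refine (((hgn.comp (measurable_fst.comp measurable_fst)).mul (hgn.comp (measurable_snd.comp measurable_fst))).mul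
      (hK3 (measurable_fst.comp measurable_snd).norm (measurable_snd.comp measurable_snd).norm ?_)).mul ?_
    · exact ((measurable_fst.comp measurable_snd).neg.sub (measurable_snd.comp measurable_snd)).norm
    · refine hh.comp ((measurable_qrotFun_star_uncurry.comp ((measurable_fst.comp measurable_fst).prodMk
        (measurable_fst.comp measurable_snd))).prodMk ((measurable_qrotFun_star_uncurry.comp
        ((measurable_snd.comp measurable_fst).prodMk (measurable_snd.comp measurable_snd))).prodMk ?_))
      exact (measurable_fst.comp measurable_snd).neg.sub (measurable_snd.comp measurable_snd)
  show ∫⁻ y, Ψ y = _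
  rw [Measure.volume_eq_prod, lintegral_prod_symm Ψ hΨm.aemeasurable]
  -- Step 2: the shear `(p₁, p₂) = (p₁, -p₁ - z)`
  set F : ℝ³ × ℝ³ → ℝ≥0∞ := fun p => ∫⁻ bc : ℍ × ℍ, Ψ (bc, p) with hF
  have hFm : Measurable F := hΨm.lintegral_prod_left'
  rw [show (∫⁻ p : ℝ³ × ℝ³, ∫⁻ bc : ℍ × ℍ, Ψ (bc, p)) = ∫⁻ p, F p from rfl,
    ← measurePreserving_shearNeg.lintegral_comp hFm]
  -- Step 3: the aligned two-slot integral
  set Φ : ℝ³ → ℝ → ℝ → ℝ≥0∞ := fun z r₁ r₂ => K r₁ r₂ ‖z‖ *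
    ∫⁻ bc : ℍ × ℍ, g ‖bc.1‖ * g ‖bc.2‖ * h (r₁ • qrotFun (star bc.1) ksE0, r₂ • qrotFun (star bc.2) ksE0, z) with hΦ
  have hΦm : Measurable fun x : ℝ³ × ℝ × ℝ => Φ x.1 x.2.1 x.2.2 := by
    rw [hΦ]
    exact (hK3 (measurable_fst.comp measurable_snd) (measurable_snd.comp measurable_snd) measurable_fst.norm).mul
      (measurable_twoSlot g hg h hh).lintegral_prod_right'
  have hstep3 : ∀ x : ℝ³ × ℝ³, F (x.1, -x.1 - x.2) = Φ x.2 ‖x.1‖ ‖x.1 + x.2‖ := by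
    rintro ⟨p₁, z⟩
    simp only [hF, hΨ, hΦ]
    have hz : -p₁ - (-p₁ - z) = z := by abel
    have hn : ‖-p₁ - z‖ = ‖p₁ + z‖ := by rw [← norm_neg]; congr 1; abel
    simp only [hz, hn]
    set K' := K ‖p₁‖ ‖p₁ + z‖ ‖z‖ with hK'
    -- both sides as iterated integrals over `b` then `c`
    rw [Measure.volume_eq_prod, lintegral_prod _ (Measurable.aemeasurable ?_),
      lintegral_prod _ (hmbc _ _ _).aemeasurable]
    swap
    · refine (((hgn.comp measurable_fst).mul (hgn.comp measurable_snd)).mul measurable_const).mul ?_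
      exact hh.comp ((measurable_qrotFun_star_uncurry.comp (measurable_fst.prodMk measurable_const)).prodMk
        ((measurable_qrotFun_star_uncurry.comp (measurable_snd.prodMk measurable_const)).prodMk measurable_const))
    -- align `c` for each `b`
    have hc : ∀ b : ℍ, ∫⁻ c : ℍ, g ‖b‖ * g ‖c‖ * K' * h (qrotFun (star b) p₁, qrotFun (star c) (-p₁ - z), z) =
        g ‖b‖ * K' * ∫⁻ c : ℍ, g ‖c‖ * h (qrotFun (star b) p₁, ‖p₁ + z‖ • qrotFun (star c) ksE0, z) := by
      intro b
      rw [← hn, ← lintegral_align g (-p₁ - z) (fun w => h (qrotFun (star b) p₁, w, z)),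
        ← lintegral_const_mul _ (hmu _ _ _)]
      refine lintegral_congr fun c => ?_
      ring
    simp_rw [hc]
    -- align `b`
    have hb := lintegral_align g p₁ (fun w => K' * ∫⁻ c : ℍ, g ‖c‖ * h (w, ‖p₁ + z‖ • qrotFun (star c) ksE0, z))
    simp only [← mul_assoc] at hb
    rw [hb, ← lintegral_const_mul _ (hmbc _ _ _).lintegral_prod_right']
    refine lintegral_congr fun b => ?_
    rw [mul_comm (g ‖b‖) K', mul_assoc, ← lintegral_const_mul _ (hmc _ _ _)]
    congr 1
    refine lintegral_congr fun c => ?_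
    ring
  simp_rw [hstep3]
  -- Step 4: `z` outside and bipolar coordinates in `p₁`
  rw [Measure.volume_eq_prod, lintegral_prod_symm (fun a : ℝ³ × ℝ³ => Φ a.2 ‖a.1‖ ‖a.1 + a.2‖)
    (by exact (hΦm.comp (measurable_snd.prodMk
      (measurable_fst.norm.prodMk (measurable_fst.add measurable_snd).norm))).aemeasurable)]
  have hz0 : ∀ᵐ z : ℝ³, z ≠ 0 := by
    have h0 : (volume : Measure ℝ³) {(0 : ℝ³)} = 0 := measure_singleton 0
    have h1 : ∀ᵐ z : ℝ³, z ∉ ({(0 : ℝ³)} : Set ℝ³) := compl_mem_ae_iff.mpr h0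
    exact h1.mono fun z hz => hz
  have hstep4 : ∀ z : ℝ³, z ≠ 0 → ∫⁻ p₁ : ℝ³, Φ z ‖p₁‖ ‖p₁ + z‖ =
      ENNReal.ofReal (2 * π / ‖z‖) * ∫⁻ r₁ in Ioi (0 : ℝ), ∫⁻ r₂ in Ioo |‖z‖ - r₁| (‖z‖ + r₁),
        ENNReal.ofReal (r₁ * r₂) * Φ z r₁ r₂ := fun z hz =>
    lintegral_norm_norm_add hz (Φ z) (hΦm.comp (measurable_const.prodMk measurable_id))
  rw [lintegral_congr_ae (hz0.mono fun z hz => hstep4 z hz)]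
  -- Step 5: `(Kr)` in the slot `c` (variable `r₂`), for fixed `z, r₁, b`
  have hstep5 : ∀ (z : ℝ³) (r₁ : ℝ), 0 < r₁ →
      ∫⁻ r₂ in Ioo |‖z‖ - r₁| (‖z‖ + r₁), ENNReal.ofReal (r₁ * r₂) * Φ z r₁ r₂ =
        ∫⁻ b : ℍ, cK * ∫⁻ x₂ : ℝ³, h (r₁ • qrotFun (star b) ksE0, x₂, z) *
          (Ioo |‖z‖ - r₁| (‖z‖ + r₁)).indicator (fun r₂ => ENNReal.ofReal (r₁ * r₂) * K r₁ r₂ ‖z‖ * g ‖b‖) ‖x₂‖ *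
            ENNReal.ofReal (‖x₂‖ ^ 2)⁻¹ := by
    intro z r₁ hr₁
    have hα : 0 ≤ |‖z‖ - r₁| := abs_nonneg _
    -- expand `Φ` and move everything inside the `(b, c)` integrals
    have e1 : ∀ r₂ : ℝ, ENNReal.ofReal (r₁ * r₂) * Φ z r₁ r₂ =
        ∫⁻ b : ℍ, ∫⁻ c : ℍ, g ‖c‖ * (ENNReal.ofReal (r₁ * r₂) * K r₁ r₂ ‖z‖ * g ‖b‖) *
          h (r₁ • qrotFun (star b) ksE0, r₂ • qrotFun (star c) ksE0, z) := by
      intro r₂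
      rw [hΦ]
      simp only
      rw [← mul_assoc, Measure.volume_eq_prod, lintegral_prod _ (hmbc _ _ _).aemeasurable,
        ← lintegral_const_mul _ ((hmbc _ _ _).lintegral_prod_right')]
      refine lintegral_congr fun b => ?_
      rw [← lintegral_const_mul _ (hmbc' _ _ _ _)]
      refine lintegral_congr fun c => ?_
      ring
    simp_rw [e1]
    -- swap `r₂` and `b`
    have hI : Measurable (Function.uncurry fun (r₂ : ℝ) (b : ℍ) => ∫⁻ c : ℍ,
        g ‖c‖ * (ENNReal.ofReal (r₁ * r₂) * K r₁ r₂ ‖z‖ * g ‖b‖) *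
          h (r₁ • qrotFun (star b) ksE0, r₂ • qrotFun (star c) ksE0, z)) := by
      refine Measurable.lintegral_prod_right' (f := fun x : (ℝ × ℍ) × ℍ =>
        g ‖x.2‖ * (ENNReal.ofReal (r₁ * x.1.1) * K r₁ x.1.1 ‖z‖ * g ‖x.1.2‖) *
          h (r₁ • qrotFun (star x.1.2) ksE0, x.1.1 • qrotFun (star x.2) ksE0, z)) ?_
      refine ((hgn.comp measurable_snd).mul (((ENNReal.measurable_ofReal.comp
        ((measurable_fst.comp measurable_fst).const_mul r₁)).mul
        (hK3 measurable_const (measurable_fst.comp measurable_fst) measurable_const)).mul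
        (hgn.comp (measurable_snd.comp measurable_fst)))).mul ?_
      exact hh.comp (((hsv r₁).comp (measurable_snd.comp measurable_fst)).prodMk
        ((measurable_slotVec.comp ((measurable_fst.comp measurable_fst).prodMk measurable_snd)).prodMk
          measurable_const))
    rw [lintegral_lintegral_swap hI.aemeasurable]
    refine lintegral_congr fun b => ?_
    -- `(Kr)` on the interval
    have := lintegral_rot_radial_Ioo g hg
      (fun r₂ => ENNReal.ofReal (r₁ * r₂) * K r₁ r₂ ‖z‖ * g ‖b‖)
      (((ENNReal.measurable_ofReal.comp (measurable_id.const_mul r₁)).mul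
        (hK3 measurable_const measurable_id measurable_const)).mul measurable_const)
      (fun x₂ => h (r₁ • qrotFun (star b) ksE0, x₂, z))
      (hh.comp (measurable_const.prodMk (measurable_id.prodMk measurable_const))) hα (β := ‖z‖ + r₁)
    rw [← hcK] at this
    rw [← this]
  -- Step 6: rewrite with Step 5 inside `r₁ ∈ (0,∞)`, bring `x₂` outside, `(Kr)` in the slot `b`
  -- the slot-`b` radial weight, as a function of `r₁` for fixed `z, x₂`
  set Φ₁ : ℝ³ → ℝ³ → ℝ → ℝ≥0∞ := fun z x₂ r₁ =>
    {r : ℝ | ‖x₂‖ ∈ Ioo |‖z‖ - r| (‖z‖ + r)}.indicator (fun r => ENNReal.ofReal (r * ‖x₂‖) * K r ‖x₂‖ ‖z‖) r₁ *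
      ENNReal.ofReal (‖x₂‖ ^ 2)⁻¹ with hΦ₁
  clear_value Φ₁
  have hΦ₁m : ∀ z : ℝ³, Measurable fun y : ℝ³ × ℝ => Φ₁ z y.1 y.2 := by
    intro z
    rw [hΦ₁]
    refine (Measurable.ite ?_ ((ENNReal.measurable_ofReal.comp (measurable_snd.mul measurable_fst.norm)).mul
      (hK3 measurable_snd measurable_fst.norm measurable_const)) measurable_const).mul
      (ENNReal.measurable_ofReal.comp (measurable_fst.norm.pow_const 2).inv)
    simp only [mem_Ioo, setOf_and]
    refine (measurableSet_lt (continuous_abs.measurable.comp (measurable_const.sub measurable_snd))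
      measurable_fst.norm).inter (measurableSet_lt measurable_fst.norm (measurable_const.add measurable_snd))
  have hind : ∀ (z x₂ : ℝ³) (r₁ : ℝ) (b : ℍ) (A : ℝ≥0∞),
      A * (Ioo |‖z‖ - r₁| (‖z‖ + r₁)).indicator (fun r₂ => ENNReal.ofReal (r₁ * r₂) * K r₁ r₂ ‖z‖ * g ‖b‖) ‖x₂‖ *
        ENNReal.ofReal (‖x₂‖ ^ 2)⁻¹ = A * (g ‖b‖ * Φ₁ z x₂ r₁) := by
    intro z x₂ r₁ b A
    rw [mul_assoc]
    congr 1
    rw [hΦ₁]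
    beta_reduce
    by_cases hm : ‖x₂‖ ∈ Ioo |‖z‖ - r₁| (‖z‖ + r₁)
    · rw [indicator_of_mem hm, indicator_of_mem (show r₁ ∈ {r : ℝ | ‖x₂‖ ∈ Ioo |‖z‖ - r| (‖z‖ + r)} from hm)]
      ring
    · rw [indicator_of_notMem hm, indicator_of_notMem (show r₁ ∉ {r : ℝ | ‖x₂‖ ∈ Ioo |‖z‖ - r| (‖z‖ + r)} from hm)]
      simp
  -- the three-fold integrand after both `(Kr)` steps
  set W : ℝ³ → ℝ³ → ℝ³ → ℝ≥0∞ := fun z x₂ x₁ =>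
    cK * (cK * (h (x₁, x₂, z) * Φ₁ z x₂ ‖x₁‖ * ENNReal.ofReal (‖x₁‖ ^ 2)⁻¹)) with hW
  clear_value W
  have hWm : ∀ z : ℝ³, Measurable (Function.uncurry (W z)) := by
    intro z
    rw [hW]
    refine Measurable.const_mul (Measurable.const_mul ?_ _) _
    exact ((hh.comp (measurable_snd.prodMk (measurable_fst.prodMk measurable_const))).mul
      ((hΦ₁m z).comp (measurable_fst.prodMk measurable_snd.norm))).mul
      (ENNReal.measurable_ofReal.comp (measurable_snd.norm.pow_const 2).inv)
  have hstep6 : ∀ z : ℝ³,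
      ∫⁻ r₁ in Ioi (0 : ℝ), ∫⁻ r₂ in Ioo |‖z‖ - r₁| (‖z‖ + r₁), ENNReal.ofReal (r₁ * r₂) * Φ z r₁ r₂ =
        ∫⁻ x₂ : ℝ³, ∫⁻ x₁ : ℝ³, W z x₂ x₁ := by
    intro z
    -- the `(r₁, b, x₂)` integrand `J`
    have hJm : Measurable fun y : (ℝ × ℍ) × ℝ³ =>
        h (y.1.1 • qrotFun (star y.1.2) ksE0, y.2, z) * (g ‖y.1.2‖ * Φ₁ z y.2 y.1.1) :=
      (hh.comp ((measurable_slotVec.comp measurable_fst).prodMk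
        (measurable_snd.prodMk measurable_const))).mul ((hgn.comp (measurable_snd.comp measurable_fst)).mul
        ((hΦ₁m z).comp (measurable_snd.prodMk (measurable_fst.comp measurable_fst))))
    have hJbx : ∀ r₁ : ℝ, Measurable (Function.uncurry fun (b : ℍ) (x₂ : ℝ³) =>
        h (r₁ • qrotFun (star b) ksE0, x₂, z) * (g ‖b‖ * Φ₁ z x₂ r₁)) := fun r₁ =>
      hJm.comp (f := fun y : ℍ × ℝ³ => ((r₁, y.1), y.2)) ((measurable_const.prodMk measurable_fst).prodMk measurable_snd)
    have hJrx : Measurable fun y : (ℝ × ℝ³) × ℍ =>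
        h (y.1.1 • qrotFun (star y.2) ksE0, y.1.2, z) * (g ‖y.2‖ * Φ₁ z y.1.2 y.1.1) :=
      hJm.comp (f := fun y : (ℝ × ℝ³) × ℍ => ((y.1.1, y.2), y.1.2))
        (((measurable_fst.comp measurable_fst).prodMk measurable_snd).prodMk (measurable_snd.comp measurable_fst))
    have hXm : Measurable fun y : ℝ³ × ℝ³ =>
        h (y.2, y.1, z) * Φ₁ z y.1 ‖y.2‖ * ENNReal.ofReal (‖y.2‖ ^ 2)⁻¹ :=
      ((hh.comp (measurable_snd.prodMk (measurable_fst.prodMk measurable_const))).mul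
        ((hΦ₁m z).comp (measurable_fst.prodMk measurable_snd.norm))).mul
        (ENNReal.measurable_ofReal.comp (measurable_snd.norm.pow_const 2).inv)
    have hX1 : ∀ x₂ : ℝ³, Measurable fun x₁ : ℝ³ =>
        h (x₁, x₂, z) * Φ₁ z x₂ ‖x₁‖ * ENNReal.ofReal (‖x₁‖ ^ 2)⁻¹ := fun x₂ =>
      hXm.comp (f := fun x₁ : ℝ³ => (x₂, x₁)) (measurable_const.prodMk measurable_id)
    calc ∫⁻ r₁ in Ioi (0 : ℝ), ∫⁻ r₂ in Ioo |‖z‖ - r₁| (‖z‖ + r₁), ENNReal.ofReal (r₁ * r₂) * Φ z r₁ r₂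
        = ∫⁻ r₁ in Ioi (0 : ℝ), ∫⁻ b : ℍ, cK * ∫⁻ x₂ : ℝ³,
            h (r₁ • qrotFun (star b) ksE0, x₂, z) * (g ‖b‖ * Φ₁ z x₂ r₁) := by
          refine setLIntegral_congr_fun measurableSet_Ioi fun r₁ hr₁ => ?_
          rw [hstep5 z r₁ hr₁]
          refine lintegral_congr fun b => ?_
          congr 1
          exact lintegral_congr fun x₂ => hind z x₂ r₁ b _
      _ = cK * ∫⁻ r₁ in Ioi (0 : ℝ), ∫⁻ x₂ : ℝ³, ∫⁻ b : ℍ,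
            h (r₁ • qrotFun (star b) ksE0, x₂, z) * (g ‖b‖ * Φ₁ z x₂ r₁) := by
          have e1 : ∀ r₁ : ℝ, (∫⁻ b : ℍ, cK * ∫⁻ x₂ : ℝ³,
              h (r₁ • qrotFun (star b) ksE0, x₂, z) * (g ‖b‖ * Φ₁ z x₂ r₁)) =
              cK * ∫⁻ x₂ : ℝ³, ∫⁻ b : ℍ, h (r₁ • qrotFun (star b) ksE0, x₂, z) * (g ‖b‖ * Φ₁ z x₂ r₁) := by
            intro r₁
            have hm0 : Measurable fun b : ℍ => ∫⁻ x₂ : ℝ³,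
                h (r₁ • qrotFun (star b) ksE0, x₂, z) * (g ‖b‖ * Φ₁ z x₂ r₁) := (hJbx r₁).lintegral_prod_right'
            rw [lintegral_const_mul _ hm0, lintegral_lintegral_swap (hJbx r₁).aemeasurable]
          simp_rw [e1]
          have hm1 : Measurable fun r₁ : ℝ => ∫⁻ x₂ : ℝ³, ∫⁻ b : ℍ,
              h (r₁ • qrotFun (star b) ksE0, x₂, z) * (g ‖b‖ * Φ₁ z x₂ r₁) :=
            (hJrx.lintegral_prod_right').lintegral_prod_right'
          rw [lintegral_const_mul _ hm1]
      _ = cK * ∫⁻ x₂ : ℝ³, ∫⁻ r₁ in Ioi (0 : ℝ), ∫⁻ b : ℍ,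
            h (r₁ • qrotFun (star b) ksE0, x₂, z) * (g ‖b‖ * Φ₁ z x₂ r₁) := by
          rw [lintegral_lintegral_swap (f := fun (r₁ : ℝ) (x₂ : ℝ³) => ∫⁻ b : ℍ,
            h (r₁ • qrotFun (star b) ksE0, x₂, z) * (g ‖b‖ * Φ₁ z x₂ r₁)) (hJrx.lintegral_prod_right').aemeasurable]
      _ = cK * ∫⁻ x₂ : ℝ³, cK * ∫⁻ x₁ : ℝ³, h (x₁, x₂, z) * Φ₁ z x₂ ‖x₁‖ * ENNReal.ofReal (‖x₁‖ ^ 2)⁻¹ := by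
          congr 1
          refine lintegral_congr fun x₂ => ?_
          have := lintegral_rot_radial g hg (Φ₁ z x₂) ((hΦ₁m z).comp (measurable_const.prodMk measurable_id))
            (fun x₁ => h (x₁, x₂, z)) (hh.comp (measurable_id.prodMk measurable_const))
          rw [← hcK] at this
          rw [← this]
          refine setLIntegral_congr_fun measurableSet_Ioi fun r₁ _ => lintegral_congr fun b => ?_
          ring
      _ = ∫⁻ x₂ : ℝ³, ∫⁻ x₁ : ℝ³, W z x₂ x₁ := by
          have hm2 : Measurable fun x₂ : ℝ³ => cK * ∫⁻ x₁ : ℝ³,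
              h (x₁, x₂, z) * Φ₁ z x₂ ‖x₁‖ * ENNReal.ofReal (‖x₁‖ ^ 2)⁻¹ := (hXm.lintegral_prod_right').const_mul _
          rw [← lintegral_const_mul _ hm2]
          refine lintegral_congr fun x₂ => ?_
          have hm3 : Measurable fun x₁ : ℝ³ =>
              cK * (h (x₁, x₂, z) * Φ₁ z x₂ ‖x₁‖ * ENNReal.ofReal (‖x₁‖ ^ 2)⁻¹) := (hX1 x₂).const_mul _
          rw [← lintegral_const_mul _ (hX1 x₂), ← lintegral_const_mul _ hm3]
          simp only [hW]
  simp_rw [hstep6]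
  -- Step 7: the right-hand side as an iterated integral, constants inside
  set T : ℝ³ × ℝ³ × ℝ³ → ℝ≥0∞ := fun ζ => triWeight K ζ * h ζ with hT
  have hTm : Measurable T := (measurable_triWeight hK).mul hh
  have hT3 : Measurable fun y : (ℝ³ × ℝ³) × ℝ³ => T (y.2, y.1.2, y.1.1) :=
    hTm.comp (measurable_snd.prodMk ((measurable_snd.comp measurable_fst).prodMk (measurable_fst.comp measurable_fst)))
  have hrhs : (∫⁻ ζ : ℝ³ × ℝ³ × ℝ³, triWeight K ζ * h ζ) = ∫⁻ z : ℝ³, ∫⁻ x₂ : ℝ³, ∫⁻ x₁ : ℝ³, T (x₁, x₂, z) := by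
    show (∫⁻ ζ, T ζ) = _
    rw [Measure.volume_eq_prod, lintegral_prod_symm T hTm.aemeasurable, Measure.volume_eq_prod,
      lintegral_prod_symm (fun yz : ℝ³ × ℝ³ => ∫⁻ x₁ : ℝ³, T (x₁, yz))
        (by exact (hTm.comp (measurable_snd.prodMk measurable_fst)).lintegral_prod_right'.aemeasurable)]
  have hT2 : Measurable fun z : ℝ³ => ∫⁻ x₂ : ℝ³, ∫⁻ x₁ : ℝ³, T (x₁, x₂, z) :=
    (hT3.lintegral_prod_right').lintegral_prod_right'
  rw [hrhs, ← lintegral_const_mul _ hT2]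
  refine lintegral_congr_ae (hz0.mono fun z hz => ?_)
  beta_reduce
  have hT1 : Measurable fun x₂ : ℝ³ => ∫⁻ x₁ : ℝ³, T (x₁, x₂, z) :=
    (hT3.comp (f := fun y : ℝ³ × ℝ³ => ((z, y.1), y.2))
      ((measurable_const.prodMk measurable_fst).prodMk measurable_snd)).lintegral_prod_right'
  have hT0 : ∀ x₂ : ℝ³, Measurable fun x₁ : ℝ³ => T (x₁, x₂, z) := fun x₂ =>
    hTm.comp (measurable_id.prodMk measurable_const)
  rw [← lintegral_const_mul' _ _ ENNReal.ofReal_ne_top, ← lintegral_const_mul _ hT1]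
  refine lintegral_congr fun x₂ => ?_
  rw [← lintegral_const_mul' _ _ ENNReal.ofReal_ne_top, ← lintegral_const_mul _ (hT0 x₂)]
  refine lintegral_congr fun x₁ => ?_
  -- Step 8: the pointwise identity of the weights
  rw [hT, hW, hΦ₁]
  unfold triWeight
  simp only
  have hL : 0 < ‖z‖ := norm_pos_iff.mpr hz
  by_cases hm : ‖x₂‖ ∈ Ioo |‖z‖ - ‖x₁‖| (‖z‖ + ‖x₁‖)
  · rw [indicator_of_mem (show ‖x₁‖ ∈ {r : ℝ | ‖x₂‖ ∈ Ioo |‖z‖ - r| (‖z‖ + r)} from hm), indicator_of_mem hm]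
    have hr₂ : 0 < ‖x₂‖ := lt_of_le_of_lt (abs_nonneg _) hm.1
    have hr₁ : 0 < ‖x₁‖ := by
      by_contra h0
      have h0' : ‖x₁‖ = 0 := le_antisymm (not_lt.mp h0) (norm_nonneg _)
      rw [h0', sub_zero, add_zero, abs_of_pos hL] at hm
      exact lt_irrefl _ (hm.1.trans hm.2)
    have hsc : ENNReal.ofReal (2 * π / ‖z‖) * (ENNReal.ofReal (‖x₁‖ * ‖x₂‖) * ENNReal.ofReal (‖x₂‖ ^ 2)⁻¹ *
        ENNReal.ofReal (‖x₁‖ ^ 2)⁻¹) = ENNReal.ofReal (2 * π) * ENNReal.ofReal (‖x₁‖ * ‖x₂‖ * ‖z‖)⁻¹ := by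
      rw [← ENNReal.ofReal_mul (by positivity), ← ENNReal.ofReal_mul (by positivity),
        ← ENNReal.ofReal_mul (by positivity), ← ENNReal.ofReal_mul (by positivity)]
      congr 1
      field_simp
    calc _ = cK * cK * K ‖x₁‖ ‖x₂‖ ‖z‖ * h (x₁, x₂, z) * (ENNReal.ofReal (2 * π / ‖z‖) *
          (ENNReal.ofReal (‖x₁‖ * ‖x₂‖) * ENNReal.ofReal (‖x₂‖ ^ 2)⁻¹ * ENNReal.ofReal (‖x₁‖ ^ 2)⁻¹)) := by ring
      _ = _ := by rw [hsc]; ring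
  · rw [indicator_of_notMem (show ‖x₁‖ ∉ {r : ℝ | ‖x₂‖ ∈ Ioo |‖z‖ - r| (‖z‖ + r)} from hm), indicator_of_notMem hm]
    simp

end PairDisintegration
section GaugeAverage
open Set MeasureTheory.Measure ENNReal

attribute [local instance] quatMeasurableSpace quatBorelSpace

/-! ### Gauge fixing `(D1)`: the third quaternion is absorbed into an average of the weight -/

/-- **Gauge fixing.** In the three-quaternion average, the quaternion `a` acting on the closing
frequency `p₃ = -p₁-p₂` can be removed at the price of replacing the weight `χ(p₁,p₂)` by its
rotation average `χ̄(p) = ∫ g(|a|) χ(ρ(a)p₁, ρ(a)p₂) da`: substitute `(b, c, p₁, p₂) ↦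
(u b, u c, ρ(u)p₁, ρ(u)p₂)` with `u = a/|a|` (a measure-preserving map), under which
`ρ((ub)‾) ρ(u) p₁ = ρ(b̄) p₁` and `ρ(ā) ρ(u) p₃ = p₃`.  This is the "averaging over `S`" of
Tao's ansatz (3.19)–(3.20) (§3.7), run backwards. [cite: Tao2016AveragedNS, §3.7 p. 19] -/
theorem lintegral_gauge_average (g : ℝ → ℝ≥0∞) (hg : Measurable g) (χ : ℝ³ × ℝ³ → ℝ≥0∞) (hχ : Measurable χ)
    (h : ℝ³ × ℝ³ × ℝ³ → ℝ≥0∞) (hh : Measurable h) :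
    ∫⁻ x : (ℍ × ℍ × ℍ) × (ℝ³ × ℝ³), g ‖x.1.1‖ * g ‖x.1.2.1‖ * g ‖x.1.2.2‖ * χ x.2 *
        h (qrotFun (star x.1.2.1) x.2.1, qrotFun (star x.1.2.2) x.2.2, qrotFun (star x.1.1) (-x.2.1 - x.2.2)) =
      ∫⁻ y : (ℍ × ℍ) × (ℝ³ × ℝ³), g ‖y.1.1‖ * g ‖y.1.2‖ *
        (∫⁻ a : ℍ, g ‖a‖ * χ (qrotFun a y.2.1, qrotFun a y.2.2)) *
          h (qrotFun (star y.1.1) y.2.1, qrotFun (star y.1.2) y.2.2, -y.2.1 - y.2.2) := by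
  have hgn : Measurable fun b : ℍ => g ‖b‖ := hg.comp measurable_norm
  -- coordinate measurability on `X := (ℍ × ℍ × ℍ) × (ℝ³ × ℝ³)`
  have mA : Measurable fun x : (ℍ × ℍ × ℍ) × (ℝ³ × ℝ³) => x.1.1 := measurable_fst.comp measurable_fst
  have mB : Measurable fun x : (ℍ × ℍ × ℍ) × (ℝ³ × ℝ³) => x.1.2.1 :=
    (measurable_fst.comp measurable_snd).comp measurable_fst
  have mC : Measurable fun x : (ℍ × ℍ × ℍ) × (ℝ³ × ℝ³) => x.1.2.2 :=
    (measurable_snd.comp measurable_snd).comp measurable_fst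
  have mP1 : Measurable fun x : (ℍ × ℍ × ℍ) × (ℝ³ × ℝ³) => x.2.1 := measurable_fst.comp measurable_snd
  have mP2 : Measurable fun x : (ℍ × ℍ × ℍ) × (ℝ³ × ℝ³) => x.2.2 := measurable_snd.comp measurable_snd
  have mP3 : Measurable fun x : (ℍ × ℍ × ℍ) × (ℝ³ × ℝ³) => -x.2.1 - x.2.2 := mP1.neg.sub mP2
  have mZ1 : Measurable fun x : (ℍ × ℍ × ℍ) × (ℝ³ × ℝ³) => qrotFun (star x.1.2.1) x.2.1 := mB.qrotFun_star mP1
  have mZ2 : Measurable fun x : (ℍ × ℍ × ℍ) × (ℝ³ × ℝ³) => qrotFun (star x.1.2.2) x.2.2 := mC.qrotFun_star mP2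
  have mZ3 : Measurable fun x : (ℍ × ℍ × ℍ) × (ℝ³ × ℝ³) => qrotFun (star x.1.1) (-x.2.1 - x.2.2) :=
    mA.qrotFun_star mP3
  -- the integrand and its measurability
  set Ψ : (ℍ × ℍ × ℍ) × (ℝ³ × ℝ³) → ℝ≥0∞ := fun x => g ‖x.1.1‖ * g ‖x.1.2.1‖ * g ‖x.1.2.2‖ * χ x.2 *
    h (qrotFun (star x.1.2.1) x.2.1, qrotFun (star x.1.2.2) x.2.2, qrotFun (star x.1.1) (-x.2.1 - x.2.2)) with hΨ
  have hΨm : Measurable Ψ := by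
    rw [hΨ]
    exact ((((hgn.comp mA).mul (hgn.comp mB)).mul (hgn.comp mC)).mul (hχ.comp measurable_snd)).mul
      (hh.comp (mZ1.prodMk (mZ2.prodMk mZ3)))
  -- coordinate measurability on `Y := (ℍ × ℍ) × (ℝ³ × ℝ³)`
  have nB : Measurable fun y : (ℍ × ℍ) × (ℝ³ × ℝ³) => y.1.1 := measurable_fst.comp measurable_fst
  have nC : Measurable fun y : (ℍ × ℍ) × (ℝ³ × ℝ³) => y.1.2 := measurable_snd.comp measurable_fst
  have nP1 : Measurable fun y : (ℍ × ℍ) × (ℝ³ × ℝ³) => y.2.1 := measurable_fst.comp measurable_snd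
  have nP2 : Measurable fun y : (ℍ × ℍ) × (ℝ³ × ℝ³) => y.2.2 := measurable_snd.comp measurable_snd
  have nZ1 : Measurable fun y : (ℍ × ℍ) × (ℝ³ × ℝ³) => qrotFun (star y.1.1) y.2.1 := nB.qrotFun_star nP1
  have nZ2 : Measurable fun y : (ℍ × ℍ) × (ℝ³ × ℝ³) => qrotFun (star y.1.2) y.2.2 := nC.qrotFun_star nP2
  have hΘm : Measurable fun y : (ℍ × ℍ) × (ℝ³ × ℝ³) => g ‖y.1.1‖ * g ‖y.1.2‖ *
      h (qrotFun (star y.1.1) y.2.1, qrotFun (star y.1.2) y.2.2, -y.2.1 - y.2.2) :=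
    ((hgn.comp nB).mul (hgn.comp nC)).mul (hh.comp (nZ1.prodMk (nZ2.prodMk (nP1.neg.sub nP2))))
  have hAm : Measurable (Function.uncurry fun (a : ℍ) (y : (ℍ × ℍ) × (ℝ³ × ℝ³)) =>
      g ‖a‖ * χ (qrotFun a y.2.1, qrotFun a y.2.2) * (g ‖y.1.1‖ * g ‖y.1.2‖ *
        h (qrotFun (star y.1.1) y.2.1, qrotFun (star y.1.2) y.2.2, -y.2.1 - y.2.2))) := by
    have k1 : Measurable fun w : ℍ × ((ℍ × ℍ) × (ℝ³ × ℝ³)) => qrotFun w.1 w.2.2.1 :=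
      measurable_fst.qrotFun (nP1.comp measurable_snd)
    have k2 : Measurable fun w : ℍ × ((ℍ × ℍ) × (ℝ³ × ℝ³)) => qrotFun w.1 w.2.2.2 :=
      measurable_fst.qrotFun (nP2.comp measurable_snd)
    exact ((hgn.comp measurable_fst).mul (hχ.comp (k1.prodMk k2))).mul (hΘm.comp measurable_snd)
  -- Step 1: regroup, `a` outside
  show ∫⁻ x, Ψ x = _
  have hΨw : Measurable fun w : ℍ × ((ℍ × ℍ) × (ℝ³ × ℝ³)) => Ψ ((w.1, w.2.1), w.2.2) := by
    have h0 := hΨm.comp (f := fun w : ℍ × ((ℍ × ℍ) × (ℝ³ × ℝ³)) => ((w.1, w.2.1), w.2.2))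
      ((measurable_fst.prodMk (measurable_fst.comp measurable_snd)).prodMk (measurable_snd.comp measurable_snd))
    exact h0
  have e0 : (∫⁻ x, Ψ x) = ∫⁻ w : ℍ × ((ℍ × ℍ) × (ℝ³ × ℝ³)), Ψ ((w.1, w.2.1), w.2.2) :=
    measurePreserving_regroup.lintegral_comp hΨw
  rw [e0, Measure.volume_eq_prod, lintegral_prod _ hΨw.aemeasurable]
  -- Step 2: gauge substitution for `a ≠ 0`
  have hae : ∀ᵐ a : ℍ, a ≠ 0 := by
    have h0 : (volume : Measure ℍ) {(0 : ℍ)} = 0 := measure_singleton 0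
    have h1 : ∀ᵐ a : ℍ, a ∉ ({(0 : ℍ)} : Set ℍ) := compl_mem_ae_iff.mpr h0
    exact h1.mono fun a ha => ha
  have hstep2 : ∀ a : ℍ, a ≠ 0 → ∫⁻ y : (ℍ × ℍ) × (ℝ³ × ℝ³), Ψ ((a, y.1), y.2) =
      ∫⁻ y : (ℍ × ℍ) × (ℝ³ × ℝ³), g ‖a‖ * χ (qrotFun a y.2.1, qrotFun a y.2.2) * (g ‖y.1.1‖ * g ‖y.1.2‖ *
        h (qrotFun (star y.1.1) y.2.1, qrotFun (star y.1.2) y.2.2, -y.2.1 - y.2.2)) := by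
    intro a ha
    have hu1 : ‖quatUnit a‖ = 1 := norm_quatUnit ha
    have hu0 : quatUnit a ≠ 0 := by intro h0; rw [h0, norm_zero] at hu1; exact zero_ne_one hu1
    have hΨa : Measurable fun y : (ℍ × ℍ) × (ℝ³ × ℝ³) => Ψ ((a, y.1), y.2) := by
      have h0 := hΨm.comp (f := fun y : (ℍ × ℍ) × (ℝ³ × ℝ³) => ((a, y.1), y.2))
        ((measurable_const.prodMk measurable_fst).prodMk measurable_snd)
      exact h0
    rw [← (measurePreserving_gauge hu1).lintegral_comp hΨa]
    refine lintegral_congr fun y => ?_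
    simp only [hΨ, norm_mul, hu1, one_mul, qrot_apply hu0]
    have e3 : qrotFun (star a) (-qrotFun (quatUnit a) y.2.1 - qrotFun (quatUnit a) y.2.2) = -y.2.1 - y.2.2 := by
      have : -qrotFun (quatUnit a) y.2.1 - qrotFun (quatUnit a) y.2.2 = qrotFun (quatUnit a) (-y.2.1 - y.2.2) := by
        rw [sub_eq_add_neg, sub_eq_add_neg, qrotFun_add, qrotFun_neg, qrotFun_neg]
      rw [this, qrotFun_star_quatUnit ha]
    rw [qrotFun_star_mul_left hu1, qrotFun_star_mul_left hu1, e3, qrotFun_quatUnit ha, qrotFun_quatUnit ha]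
    ring
  rw [lintegral_congr_ae (hae.mono fun a ha => hstep2 a ha)]
  -- Step 3: swap and factor
  rw [lintegral_lintegral_swap hAm.aemeasurable]
  refine lintegral_congr fun y => ?_
  have k3 : Measurable fun a : ℍ => g ‖a‖ * χ (qrotFun a y.2.1, qrotFun a y.2.2) :=
    hgn.mul (hχ.comp ((measurable_qrotFun_apply _).prodMk (measurable_qrotFun_apply _)))
  rw [lintegral_mul_const _ k3]
  ring

/-! ### Frame averaging: the rotation average of a frame weight is a constant -/

/-- The reference frame: `e₀ = (1,0,0)` and the north pole `(0,0,1)` are orthonormal. [folklore] -/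
theorem inner_northVec_ksE0 : ⟪northVec, ksE0⟫ = 0 := by
  simp [northVec, ksE0, real_inner_fin3]

/-- **Frame averaging.** For an orthonormal pair `(e, m)`, the average
`∫ g(|a|) B(ρ(a)e, ρ(a)m) da` does not depend on the pair (right translation by a unit
quaternion carrying the reference pair `(e₀, (0,0,1))` to `(e, m)`; this is where the
transitivity of `SO(3)` on orthonormal pairs replaces Euler's rotation theorem). [folklore] -/
theorem lintegral_frame_average (g : ℝ → ℝ≥0∞) (B : ℝ³ → ℝ³ → ℝ≥0∞) {e m : ℝ³} (he : ‖e‖ = 1) (hm : ‖m‖ = 1)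
    (hem : ⟪m, e⟫ = 0) :
    ∫⁻ a : ℍ, g ‖a‖ * B (qrotFun a e) (qrotFun a m) = ∫⁻ a : ℍ, g ‖a‖ * B (qrotFun a ksE0) (qrotFun a northVec) := by
  obtain ⟨s, hs1, hse, hsm⟩ := exists_unit_qrotFun_frame_eq norm_ksE0 norm_northVec inner_northVec_ksE0 he hm hem
  rw [← lintegral_comp_quat_mul_right hs1 (fun a => g ‖a‖ * B (qrotFun a ksE0) (qrotFun a northVec))]
  refine lintegral_congr fun a => ?_
  simp only [norm_mul, hs1, mul_one, qrotFun_mul, hse, hsm]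

/-- **The frame weight.** A weight on pairs `(p₁, p₂)` built from a radial part
`R(|p₁|, |p₂|, |p₃|)` (`p₃ = -p₁-p₂`) and a frame part `B(p₃/|p₃|, n)`, `n = (p₁ × p₂)/|p₁ × p₂|`
the unit normal of the (closed) triangle `(p₁, p₂, p₃)`. [folklore] -/
def frameWeight (R : ℝ → ℝ → ℝ → ℝ≥0∞) (B : ℝ³ → ℝ³ → ℝ≥0∞) (p : ℝ³ × ℝ³) : ℝ≥0∞ :=
  R ‖p.1‖ ‖p.2‖ ‖-p.1 - p.2‖ * B (udir (-p.1 - p.2)) (udir (cross p.1 p.2))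

/-- `udir` commutes with isometric linear maps: `udir (ρ(a) v) = ρ(a) (udir v)` (`a ≠ 0`). [folklore] -/
theorem udir_qrotFun {a : ℍ} (ha : a ≠ 0) (v : ℝ³) : udir (qrotFun a v) = qrotFun a (udir v) := by
  rw [udir, udir, norm_qrotFun ha, qrotFun_smul]

/-- **The rotation average of a frame weight**: for a non-degenerate pair (`p₁ × p₂ ≠ 0`),
`∫ g(|a|) χ(ρ(a)p₁, ρ(a)p₂) da = R(|p₁|,|p₂|,|p₃|) · c_B` with the constant
`c_B = ∫ g(|a|) B(ρ(a)e₀, ρ(a)(0,0,1)) da`. [folklore] -/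
theorem lintegral_frameWeight_average (g : ℝ → ℝ≥0∞) (hg : Measurable g) (R : ℝ → ℝ → ℝ → ℝ≥0∞)
    (B : ℝ³ → ℝ³ → ℝ≥0∞) (hB : Measurable (Function.uncurry B)) {p : ℝ³ × ℝ³} (hp : cross p.1 p.2 ≠ 0) :
    ∫⁻ a : ℍ, g ‖a‖ * frameWeight R B (qrotFun a p.1, qrotFun a p.2) =
      R ‖p.1‖ ‖p.2‖ ‖-p.1 - p.2‖ * ∫⁻ a : ℍ, g ‖a‖ * B (qrotFun a ksE0) (qrotFun a northVec) := by
  -- the closing side is non-zero and orthogonal to the normal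
  have hp3 : -p.1 - p.2 ≠ 0 := by
    intro h0
    apply hp
    have : p.2 = -p.1 := by rw [sub_eq_zero] at h0; exact h0.symm
    rw [this, ← neg_one_smul ℝ p.1, cross_smul_right, cross_self_eq_zero, smul_zero]
  set e := udir (-p.1 - p.2) with hedef
  set m := udir (cross p.1 p.2) with hmdef
  have he : ‖e‖ = 1 := norm_udir hp3
  have hm : ‖m‖ = 1 := norm_udir hp
  have hem : ⟪m, e⟫ = 0 := by
    rw [hmdef, hedef, udir, udir, real_inner_smul_left, real_inner_smul_right, inner_sub_right, inner_neg_right,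
      inner_cross_self_left, inner_cross_self_right]
    ring
  -- pointwise simplification for `a ≠ 0`
  have hpt : ∀ a : ℍ, a ≠ 0 → g ‖a‖ * frameWeight R B (qrotFun a p.1, qrotFun a p.2) =
      g ‖a‖ * B (qrotFun a e) (qrotFun a m) * R ‖p.1‖ ‖p.2‖ ‖-p.1 - p.2‖ := by
    intro a ha
    rw [frameWeight]
    simp only
    have h3 : -qrotFun a p.1 - qrotFun a p.2 = qrotFun a (-p.1 - p.2) := by
      rw [sub_eq_add_neg, sub_eq_add_neg, qrotFun_add, qrotFun_neg, qrotFun_neg]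
    rw [h3, norm_qrotFun ha, norm_qrotFun ha, norm_qrotFun ha, cross_qrotFun ha, udir_qrotFun ha, udir_qrotFun ha]
    ring
  have hae : ∀ᵐ a : ℍ, a ≠ 0 := by
    have h0 : (volume : Measure ℍ) {(0 : ℍ)} = 0 := measure_singleton 0
    have h1 : ∀ᵐ a : ℍ, a ∉ ({(0 : ℍ)} : Set ℍ) := compl_mem_ae_iff.mpr h0
    exact h1.mono fun a ha => ha
  have k4 : Measurable fun a : ℍ => g ‖a‖ * B (qrotFun a e) (qrotFun a m) :=
    (hg.comp measurable_norm).mul (hB.comp ((measurable_qrotFun_apply e).prodMk (measurable_qrotFun_apply m)))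
  rw [lintegral_congr_ae (hae.mono fun a ha => hpt a ha), lintegral_mul_const _ k4,
    lintegral_frame_average g B he hm hem, mul_comm]

/-! ### Degenerate pairs are negligible -/

/-- `p₁ × p₂ = 0` with `p₁ ≠ 0` forces `p₂ ∈ ℝ p₁`. [folklore] -/
theorem mem_span_of_cross_eq_zero {p₁ p₂ : ℝ³} (h1 : p₁ ≠ 0) (h : cross p₁ p₂ = 0) :
    p₂ ∈ Submodule.span ℝ ({p₁} : Set ℝ³) := by
  have key := cross_cross_eq_smul_sub p₁ p₁ p₂
  rw [h] at key
  have hc : cross p₁ (0 : ℝ³) = 0 := by simpa using cross_smul_right 0 p₁ p₁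
  rw [hc, real_inner_self_eq_norm_sq] at key
  have hn : ‖p₁‖ ^ 2 ≠ 0 := pow_ne_zero 2 (norm_ne_zero_iff.mpr h1)
  have hp₂ : p₂ = (⟪p₁, p₂⟫ / ‖p₁‖ ^ 2) • p₁ := by
    have : ‖p₁‖ ^ 2 • p₂ = ⟪p₁, p₂⟫ • p₁ := by rw [eq_comm, sub_eq_zero] at key; exact key.symm
    calc p₂ = (‖p₁‖ ^ 2)⁻¹ • (‖p₁‖ ^ 2 • p₂) := by rw [smul_smul, inv_mul_cancel₀ hn, one_smul]
      _ = _ := by rw [this, smul_smul, div_eq_inv_mul]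
  rw [hp₂]
  exact Submodule.smul_mem _ _ (Submodule.subset_span rfl)

/-- The line `ℝ p₁` is a proper subspace of `ℝ³`. [folklore] -/
theorem span_singleton_ne_top (p₁ : ℝ³) : Submodule.span ℝ ({p₁} : Set ℝ³) ≠ ⊤ := by
  intro htop
  by_cases h1 : p₁ = 0
  · have : (ksE0 : ℝ³) ∈ Submodule.span ℝ ({p₁} : Set ℝ³) := by rw [htop]; exact Submodule.mem_top
    rw [h1, Submodule.mem_span_singleton] at this
    obtain ⟨r, hr⟩ := this
    have := congrArg (fun v : ℝ³ => ‖v‖) hr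
    simp at this
  obtain ⟨m, hm1, hme⟩ := exists_unit_orthogonal h1
  have : m ∈ Submodule.span ℝ ({p₁} : Set ℝ³) := by rw [htop]; exact Submodule.mem_top
  rw [Submodule.mem_span_singleton] at this
  obtain ⟨r, hr⟩ := this
  have h2 : ⟪m, p₁⟫ = r * ‖p₁‖ ^ 2 := by rw [← hr, real_inner_smul_left, real_inner_self_eq_norm_sq]
  rw [hme] at h2
  have hr0 : r = 0 := by
    have hn : ‖p₁‖ ^ 2 ≠ 0 := pow_ne_zero 2 (norm_ne_zero_iff.mpr h1)
    exact (mul_eq_zero.mp h2.symm).resolve_right hn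
  rw [hr0, zero_smul] at hr
  rw [← hr, norm_zero] at hm1
  exact zero_ne_one hm1

/-- **Degenerate pairs are Lebesgue-null**: `{(p₁, p₂) : p₁ × p₂ = 0}` has measure zero in
`ℝ³ × ℝ³` (each section `{p₂ : p₁ × p₂ = 0}`, `p₁ ≠ 0`, lies in a line). [folklore] -/
theorem volume_cross_eq_zero : (volume : Measure (ℝ³ × ℝ³)) {p | cross p.1 p.2 = 0} = 0 := by
  have hS : MeasurableSet {p : ℝ³ × ℝ³ | cross p.1 p.2 = 0} :=
    (isClosed_eq (continuous_cross) continuous_const).measurableSet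
  rw [Measure.volume_eq_prod, Measure.measure_prod_null hS]
  have h0 : (volume : Measure ℝ³) {(0 : ℝ³)} = 0 := measure_singleton 0
  have h1 : ∀ᵐ p₁ : ℝ³, p₁ ∉ ({(0 : ℝ³)} : Set ℝ³) := compl_mem_ae_iff.mpr h0
  refine h1.mono fun p₁ hp₁ => ?_
  simp only [Pi.zero_apply]
  refine measure_mono_null (fun p₂ hp₂ => ?_) (Measure.addHaar_submodule volume _ (span_singleton_ne_top p₁))
  exact mem_span_of_cross_eq_zero hp₁ hp₂

end GaugeAverage
section FullDisintegration
open Set MeasureTheory.Measure ENNReal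

attribute [local instance] quatMeasurableSpace quatBorelSpace

/-! ### The rotation disintegration `(D)`: three quaternions and two free frequencies -/

/-- The **frame constant** `c_B = ∫ g(|a|) B(ρ(a) e₀, ρ(a)(0,0,1)) da`. [folklore] -/
def frameConst (g : ℝ → ℝ≥0∞) (B : ℝ³ → ℝ³ → ℝ≥0∞) : ℝ≥0∞ :=
  ∫⁻ a : ℍ, g ‖a‖ * B (qrotFun a ksE0) (qrotFun a northVec)

/-- `udir` is measurable. [folklore] -/
theorem measurable_udir : Measurable (udir : ℝ³ → ℝ³) := by
  unfold udir
  exact measurable_norm.inv.smul measurable_id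

/-- `frameWeight R B` is measurable. [folklore] -/
theorem measurable_frameWeight {R : ℝ → ℝ → ℝ → ℝ≥0∞} (hR : Measurable fun r : ℝ × ℝ × ℝ => R r.1 r.2.1 r.2.2)
    {B : ℝ³ → ℝ³ → ℝ≥0∞} (hB : Measurable (Function.uncurry B)) : Measurable (frameWeight R B) := by
  unfold frameWeight
  have h3 : Measurable fun p : ℝ³ × ℝ³ => -p.1 - p.2 := measurable_fst.neg.sub measurable_snd
  refine (hR.comp (measurable_fst.norm.prodMk (measurable_snd.norm.prodMk h3.norm))).mul ?_
  exact hB.comp ((measurable_udir.comp h3).prodMk (measurable_udir.comp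
    (continuous_cross.measurable.comp (measurable_fst.prodMk measurable_snd))))

/-- Almost every `y = ((b,c),(p₁,p₂))` has a non-degenerate pair `p₁ × p₂ ≠ 0`. [folklore] -/
theorem ae_cross_ne_zero : ∀ᵐ y : (ℍ × ℍ) × (ℝ³ × ℝ³), cross y.2.1 y.2.2 ≠ 0 := by
  have h1 : ∀ᵐ p : ℝ³ × ℝ³, p ∉ {p : ℝ³ × ℝ³ | cross p.1 p.2 = 0} := compl_mem_ae_iff.mpr volume_cross_eq_zero
  have h2 : ∀ᵐ p : ℝ³ × ℝ³, cross p.1 p.2 ≠ 0 := h1.mono fun p hp => hp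
  have := (Measure.quasiMeasurePreserving_snd (μ := (volume : Measure (ℍ × ℍ)))
    (ν := (volume : Measure (ℝ³ × ℝ³)))).ae h2
  rw [← Measure.volume_eq_prod] at this
  exact this

/-- **The rotation disintegration `(D)`** (Haar-free form of Tao's change of variables, §3.6
"by a change of variables … `F'` multiplied by some Jacobian factors"): for a radial quaternion
profile `g`, a weight on frequency pairs of the frame form `frameWeight R B` and any measurable
`h ≥ 0` on `(ℝ³)³`, the average of `h(ρ(b̄)p₁, ρ(c̄)p₂, ρ(ā)p₃)` (`p₃ = -p₁-p₂`) over three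
quaternions `a, b, c` (Lebesgue measure on `ℍ³` weighted by `g ⊗ g ⊗ g`) and two free
frequencies `(p₁, p₂)` (Lebesgue measure on `(ℝ³)²` weighted by the frame weight) is
`c_B · 2π c_K² · ∫ triWeight R ζ · h(ζ) dζ` — Lebesgue measure on `(ℝ³)³` with the explicit density
`2π c_B c_K² R(|ζ₁|,|ζ₂|,|ζ₃|) / (|ζ₁||ζ₂||ζ₃|)` on the triangle-inequality region: gauge fixing
(`lintegral_gauge_average`), frame averaging (`lintegral_frameWeight_average`, off the null set of
degenerate pairs), and the two-slot disintegration (`lintegral_pair_disintegration`). [cite: Tao2016AveragedNS, §3.6 p. 18] -/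
theorem lintegral_rotation_disintegration (g : ℝ → ℝ≥0∞) (hg : Measurable g)
    (R : ℝ → ℝ → ℝ → ℝ≥0∞) (hR : Measurable fun r : ℝ × ℝ × ℝ => R r.1 r.2.1 r.2.2)
    (B : ℝ³ → ℝ³ → ℝ≥0∞) (hB : Measurable (Function.uncurry B))
    (h : ℝ³ × ℝ³ × ℝ³ → ℝ≥0∞) (hh : Measurable h) :
    ∫⁻ x : (ℍ × ℍ × ℍ) × (ℝ³ × ℝ³), g ‖x.1.1‖ * g ‖x.1.2.1‖ * g ‖x.1.2.2‖ * frameWeight R B x.2 *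
        h (qrotFun (star x.1.2.1) x.2.1, qrotFun (star x.1.2.2) x.2.2, qrotFun (star x.1.1) (-x.2.1 - x.2.2)) =
      frameConst g B * (ENNReal.ofReal (2 * π) * (ENNReal.ofReal (π / 4) * ksRadialConst g) ^ 2) *
        ∫⁻ ζ : ℝ³ × ℝ³ × ℝ³, triWeight R ζ * h ζ := by
  rw [lintegral_gauge_average g hg _ (measurable_frameWeight hR hB) h hh]
  -- frame averaging off the null set of degenerate pairs
  have hfr : ∀ᵐ y : (ℍ × ℍ) × (ℝ³ × ℝ³),
      g ‖y.1.1‖ * g ‖y.1.2‖ * (∫⁻ a : ℍ, g ‖a‖ * frameWeight R B (qrotFun a y.2.1, qrotFun a y.2.2)) *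
          h (qrotFun (star y.1.1) y.2.1, qrotFun (star y.1.2) y.2.2, -y.2.1 - y.2.2) =
        frameConst g B * (g ‖y.1.1‖ * g ‖y.1.2‖ * R ‖y.2.1‖ ‖y.2.2‖ ‖-y.2.1 - y.2.2‖ *
          h (qrotFun (star y.1.1) y.2.1, qrotFun (star y.1.2) y.2.2, -y.2.1 - y.2.2)) := by
    refine ae_cross_ne_zero.mono fun y hy => ?_
    rw [lintegral_frameWeight_average g hg R B hB (p := y.2) hy, frameConst]
    ring
  rw [lintegral_congr_ae hfr]
  have hm : Measurable fun y : (ℍ × ℍ) × (ℝ³ × ℝ³) => g ‖y.1.1‖ * g ‖y.1.2‖ * R ‖y.2.1‖ ‖y.2.2‖ ‖-y.2.1 - y.2.2‖ *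
      h (qrotFun (star y.1.1) y.2.1, qrotFun (star y.1.2) y.2.2, -y.2.1 - y.2.2) := by
    have nB : Measurable fun y : (ℍ × ℍ) × (ℝ³ × ℝ³) => y.1.1 := measurable_fst.comp measurable_fst
    have nC : Measurable fun y : (ℍ × ℍ) × (ℝ³ × ℝ³) => y.1.2 := measurable_snd.comp measurable_fst
    have nP1 : Measurable fun y : (ℍ × ℍ) × (ℝ³ × ℝ³) => y.2.1 := measurable_fst.comp measurable_snd
    have nP2 : Measurable fun y : (ℍ × ℍ) × (ℝ³ × ℝ³) => y.2.2 := measurable_snd.comp measurable_snd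
    have nP3 : Measurable fun y : (ℍ × ℍ) × (ℝ³ × ℝ³) => -y.2.1 - y.2.2 := nP1.neg.sub nP2
    have hgn : Measurable fun b : ℍ => g ‖b‖ := hg.comp measurable_norm
    exact (((hgn.comp nB).mul (hgn.comp nC)).mul (hR.comp (nP1.norm.prodMk (nP2.norm.prodMk nP3.norm)))).mul
      (hh.comp ((nB.qrotFun_star nP1).prodMk ((nC.qrotFun_star nP2).prodMk nP3)))
  rw [lintegral_const_mul _ hm, lintegral_pair_disintegration g hg R hR h hh]
  ring

/-! ### Measure form -/

/-- The frequency map `Z : ((a,(b,c)),(p₁,p₂)) ↦ (ρ(b̄)p₁, ρ(c̄)p₂, ρ(ā)(-p₁-p₂))` of the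
rotation disintegration. [cite: Tao2016AveragedNS, §3.5 p. 17] -/
def rotFreq (x : (ℍ × ℍ × ℍ) × (ℝ³ × ℝ³)) : ℝ³ × ℝ³ × ℝ³ :=
  (qrotFun (star x.1.2.1) x.2.1, qrotFun (star x.1.2.2) x.2.2, qrotFun (star x.1.1) (-x.2.1 - x.2.2))

/-- `rotFreq` is measurable. [folklore] -/
theorem measurable_rotFreq : Measurable rotFreq := by
  unfold rotFreq
  have mA : Measurable fun x : (ℍ × ℍ × ℍ) × (ℝ³ × ℝ³) => x.1.1 := measurable_fst.comp measurable_fst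
  have mB : Measurable fun x : (ℍ × ℍ × ℍ) × (ℝ³ × ℝ³) => x.1.2.1 :=
    (measurable_fst.comp measurable_snd).comp measurable_fst
  have mC : Measurable fun x : (ℍ × ℍ × ℍ) × (ℝ³ × ℝ³) => x.1.2.2 :=
    (measurable_snd.comp measurable_snd).comp measurable_fst
  have mP1 : Measurable fun x : (ℍ × ℍ × ℍ) × (ℝ³ × ℝ³) => x.2.1 := measurable_fst.comp measurable_snd
  have mP2 : Measurable fun x : (ℍ × ℍ × ℍ) × (ℝ³ × ℝ³) => x.2.2 := measurable_snd.comp measurable_snd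
  exact (mB.qrotFun_star mP1).prodMk ((mC.qrotFun_star mP2).prodMk (mA.qrotFun_star (mP1.neg.sub mP2)))

/-- The **weight** of the rotation disintegration on `ℍ³ × (ℝ³)²`: `g ⊗ g ⊗ g ⊗ frameWeight`. [folklore] -/
def rotWeight (g : ℝ → ℝ≥0∞) (R : ℝ → ℝ → ℝ → ℝ≥0∞) (B : ℝ³ → ℝ³ → ℝ≥0∞)
    (x : (ℍ × ℍ × ℍ) × (ℝ³ × ℝ³)) : ℝ≥0∞ :=
  g ‖x.1.1‖ * g ‖x.1.2.1‖ * g ‖x.1.2.2‖ * frameWeight R B x.2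

/-- `rotWeight` is measurable. [folklore] -/
theorem measurable_rotWeight {g : ℝ → ℝ≥0∞} (hg : Measurable g) {R : ℝ → ℝ → ℝ → ℝ≥0∞}
    (hR : Measurable fun r : ℝ × ℝ × ℝ => R r.1 r.2.1 r.2.2) {B : ℝ³ → ℝ³ → ℝ≥0∞}
    (hB : Measurable (Function.uncurry B)) : Measurable (rotWeight g R B) := by
  unfold rotWeight
  have hgn : Measurable fun b : ℍ => g ‖b‖ := hg.comp measurable_norm
  exact (((hgn.comp (measurable_fst.comp measurable_fst)).mul
    (hgn.comp ((measurable_fst.comp measurable_snd).comp measurable_fst))).mul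
    (hgn.comp ((measurable_snd.comp measurable_snd).comp measurable_fst))).mul
    ((measurable_frameWeight hR hB).comp measurable_snd)

/-- **`(D)` as an identity of measures on `(ℝ³)³`**: the push-forward under `rotFreq` of Lebesgue
measure weighted by `rotWeight` is Lebesgue measure weighted by `C · triWeight R`,
`C = c_B · 2π c_K²`. [cite: Tao2016AveragedNS, §3.6 p. 18] -/
theorem map_rotFreq_withDensity (g : ℝ → ℝ≥0∞) (hg : Measurable g)
    (R : ℝ → ℝ → ℝ → ℝ≥0∞) (hR : Measurable fun r : ℝ × ℝ × ℝ => R r.1 r.2.1 r.2.2)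
    (B : ℝ³ → ℝ³ → ℝ≥0∞) (hB : Measurable (Function.uncurry B)) :
    Measure.map rotFreq ((volume : Measure ((ℍ × ℍ × ℍ) × (ℝ³ × ℝ³))).withDensity (rotWeight g R B)) =
      (volume : Measure (ℝ³ × ℝ³ × ℝ³)).withDensity (fun ζ =>
        frameConst g B * (ENNReal.ofReal (2 * π) * (ENNReal.ofReal (π / 4) * ksRadialConst g) ^ 2) *
          triWeight R ζ) := by
  refine Measure.ext fun s hs => ?_
  rw [Measure.map_apply measurable_rotFreq hs, withDensity_apply _ (measurable_rotFreq hs),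
    withDensity_apply _ hs, ← lintegral_indicator (measurable_rotFreq hs), ← lintegral_indicator hs]
  have h1 : ∀ x : (ℍ × ℍ × ℍ) × (ℝ³ × ℝ³), (rotFreq ⁻¹' s).indicator (rotWeight g R B) x =
      rotWeight g R B x * s.indicator (fun _ => (1 : ℝ≥0∞)) (rotFreq x) := by
    intro x
    by_cases hx : rotFreq x ∈ s
    · rw [indicator_of_mem (show x ∈ rotFreq ⁻¹' s from hx), indicator_of_mem hx, mul_one]
    · rw [indicator_of_notMem (show x ∉ rotFreq ⁻¹' s from hx), indicator_of_notMem hx, mul_zero]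
  have h2 : ∀ ζ : ℝ³ × ℝ³ × ℝ³, s.indicator (fun ζ => frameConst g B *
      (ENNReal.ofReal (2 * π) * (ENNReal.ofReal (π / 4) * ksRadialConst g) ^ 2) * triWeight R ζ) ζ =
      frameConst g B * (ENNReal.ofReal (2 * π) * (ENNReal.ofReal (π / 4) * ksRadialConst g) ^ 2) *
        (triWeight R ζ * s.indicator (fun _ => (1 : ℝ≥0∞)) ζ) := by
    intro ζ
    by_cases hζ : ζ ∈ s
    · rw [indicator_of_mem hζ, indicator_of_mem hζ, mul_one]
    · rw [indicator_of_notMem hζ, indicator_of_notMem hζ, mul_zero, mul_zero]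
  simp_rw [h1, h2]
  have hm2 : Measurable fun ζ : ℝ³ × ℝ³ × ℝ³ => triWeight R ζ * s.indicator (fun _ => (1 : ℝ≥0∞)) ζ :=
    (measurable_triWeight hR).mul (measurable_const.indicator hs)
  rw [lintegral_const_mul _ hm2]
  have := lintegral_rotation_disintegration g hg R hR B hB (s.indicator fun _ => 1) (measurable_const.indicator hs)
  simpa only [rotWeight, rotFreq] using this

/-- **`(D)` for Bochner integrals**: for an a.e.-strongly measurable `E`-valued `f` on `(ℝ³)³`,
`∫ f d(C · triWeight · Lebesgue) = ∫ f ∘ rotFreq d(rotWeight · Lebesgue)` (no integrability needed: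
both sides are then junk simultaneously). [cite: Tao2016AveragedNS, §3.6 p. 18] -/
theorem integral_rotFreq_withDensity {E : Type*} [NormedAddCommGroup E] [NormedSpace ℝ E]
    (g : ℝ → ℝ≥0∞) (hg : Measurable g)
    (R : ℝ → ℝ → ℝ → ℝ≥0∞) (hR : Measurable fun r : ℝ × ℝ × ℝ => R r.1 r.2.1 r.2.2)
    (B : ℝ³ → ℝ³ → ℝ≥0∞) (hB : Measurable (Function.uncurry B)) {f : ℝ³ × ℝ³ × ℝ³ → E}
    (hf : AEStronglyMeasurable f (volume : Measure (ℝ³ × ℝ³ × ℝ³))) :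
    ∫ ζ, f ζ ∂(volume : Measure (ℝ³ × ℝ³ × ℝ³)).withDensity (fun ζ =>
        frameConst g B * (ENNReal.ofReal (2 * π) * (ENNReal.ofReal (π / 4) * ksRadialConst g) ^ 2) *
          triWeight R ζ) =
      ∫ x, f (rotFreq x) ∂((volume : Measure ((ℍ × ℍ × ℍ) × (ℝ³ × ℝ³))).withDensity (rotWeight g R B)) := by
  rw [← map_rotFreq_withDensity g hg R hR B hB]
  refine integral_map measurable_rotFreq.aemeasurable ?_
  rw [map_rotFreq_withDensity g hg R hR B hB]
  exact hf.mono_ac (withDensity_absolutelyContinuous _ _)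

end FullDisintegration
end Literature.Analysis.FluidPDE.Tao2016
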